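import Literature.MathematicalPhysics.StatisticalMechanics.ComplexSpinSchwingerDyson
import HarnessLib

/-!
# Chiral long-range order at strong coupling in finite volume (Salmhofer–Seiler, CMP 139 (1991),
# (3.101)–(3.113), Thm. 4.8 (4.40)–(4.42), Remark 4.6, Cor. 4.9)

Tenth file of the Salmhofer–Seiler series.  With the infrared bound (Thm. 3.21,
`SalmhoferSeiler1991_infraredBound_holds`) and the Schwinger–Dyson lower bound (4.38)
(`ComplexSpinSchwingerDyson`) in the tree, this file carries out the remaining steps of the printed
proof of chiral long-range order (Thm. 4.8 ⇒ Cor. 4.9) **in finite volume**, everything PROVED and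
no named fact introduced:

* (3.101)/(3.106) **chiral symmetry at `m = 0`**: `⟨σ_0σ_x⟩_Λ = 0` if `ε(x)ε(0) = 1`, hence
  `T̂_Λ(k+π̂) = -T̂_Λ(k)` (here: `ĝ(π̂) = -ĝ(0)`), by the chiral charge `∑_x ε(x) L_x` of a monomial;
* (3.104)–(3.105), (3.112)–(3.113) **the infrared bound mode by mode** on the dual torus:
  `2D(k) ĝ(k) ≤ Z_Λ/N`, `-2D(k+π̂) ĝ(k) ≤ Z_Λ/N` for the symbol `ĝ(k) = ∑_x [σ_0σ_x]_Λ e^{ikx}`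
  (from the second-order Gaussian domination bounds of `ComplexSpinInfraredBoundProof` and the
  diagonalisation of `InfraredBoundSpectralStep`);
* (4.12)–(4.14)/(4.40) **the infrared form of `∑_{|y-x|=1}⟨σ_xσ_y⟩`**:
  `∑_μ ([σ_0σ_{e_μ}] + [σ_0σ_{-e_μ}]) ≤ (2ν/|Λ|)(ĝ(0) - ĝ(π̂)) + (2/N) Z_Λ S_Λ(ν)` with the
  **lattice sum** `S_Λ(ν) = |Λ|⁻¹ ∑_{k ∈ Λ*∖{0}, C(k)>0} C(k)/D(k)` of (4.3) (`C(k) = ∑_μ cos k_μ`,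
  `D = ν - C`, (4.1)), the modes with `C < 0` folded onto `ℬ⁺` by `k ↦ k + π̂` exactly as in (4.14);
* **`Z_Λ > 0`** (Def. 3.1 requires `Z ≠ 0`): the dimer configuration (3.63) has weight
  `a_N^{|Λ|/2} > 0` and all weights are `≥ 0`;
* **(4.41)–(4.42) in finite volume** (`chiralLRO_bracket`, `chiralLRO_expect`): at `m = 0`,
  `|Λ|⁻¹ ∑_x ⟨σ_0σ_x⟩_Λ ≥ (1/4ν) (1/K(N) - 2 S_Λ(ν)/N)` for every complex spin system with
  `B = exp(NW)` to order `N`, `w₁ = 1`, `w_k ≥ 0` (exactly Thm. 4.8's hypotheses: `b_k ≥ 0`, needed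
  for Thm. 3.21, is derived — `e^{NV} = e^{N(W-t)}`, `fluctCoeff_nonneg_of_hasLog`);
* **Remark 4.6 / Cor. 4.9 for `U(N)`, `N ≤ 4`** (`uN_chiralLRO`): the printed `w_k` (4.27) are
  checked to be the Taylor data of `N⁻¹ log B` for the `U(N)` bond weight (2.23) (`hasLog_uN`), they
  are `≥ 0`, and `K(1) = 1`, `K(2) = 2`, `K(3) = 10/3`, `K(4) = 5 + 8/15` (`sdK_uN_*`, reproducing
  the numbers printed in the proof of Cor. 4.9 — with the PRODUCT form of (4.29), see the ERRATUM in
  `ComplexSpinSchwingerDyson`);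
* **`N = 5` (appendix; a second ERRATUM, kernel-checked)**: the printed `w₅` of (4.27) is inconsistent
  with `B = exp(NW)` for the bond weight (2.23) (`not_hasLog_uN_five`); the correct value is
  `2N⁴(7N-12)/(5(N-1)²(N-2)(N-3)(N-4))` (`= 2875/48` at `N = 5`, `hasLog_uN_five`), giving
  `K(5) = 12227/1330 ≈ 9.19` (`sdK_uN_five`) instead of the printed "`K(5) < 7.4`"
  (`= 9827/1330`, `sdK_uN_five_printed`, which is what the misprinted `w₅` yields); `uN_chiralLRO_five`.

WHAT IS NOT DONE HERE (and why the statements are finite-volume).  The printed Thm. 4.8 / Cor. 4.9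
are statements about thermodynamic limits (Thm. 3.18(2), Banach–Alaoglu; Thm. 3.23: `T̂` a signed
measure `c_0 δ - c_π̂ δ_π̂ + ĝ`), and the final positivity `2S(ν)K(N)/N < 1` for `N ≤ 4`, `ν ≥ 4`
rests on the computer-assisted Prop. 4.2(4) (`S(4) < 0.35`, Appendix).  Neither the limit
`S_Λ(ν) → S(ν)` nor Prop. 4.2(4) is formalised; the theorems below are the uniform finite-volume
inequalities from which the printed statements follow by these two inputs.  Honest framing: exact
inequalities for a polynomial "spin system" on a finite torus at `β = 0`; nothing about `β > 0`, the
continuum, `SU(N)`, or the summit's `QCD` conjunct (the identification "strongly coupled `U(N)`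
lattice gauge theory = `U(N)` complex spin system" is Salmhofer–Seiler's §2 / Rossi–Wolff and is not
re-proved in this series).

WHAT IS PRINTED (locators).  (3.100)–(3.106) p. 415; Thm. 3.23 and (3.108)–(3.113) pp. 415–416;
Def. 4.1 (4.1)–(4.3) p. 417; (4.12)–(4.14) p. 419; Remark 4.5, Remark 4.6 (4.27) pp. 420–421;
Thm. 4.8 with (4.38)–(4.42) pp. 422–423 ("At `m = 0`, `c_0 = c_π̂` because of chiral symmetry,
(3.106), so `1 ≤ K(N)(4νc_0 + 2S(ν)/N)` (4.41), and `c_0 ≥ (1/4ν)(1/K(N) - 2S(ν)/N) > 0`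
(4.42) [printed with a misprinted `min{0,·}`] for `ν ≥ ν₀`, where `2S(ν)K(N)/N < 1`"); Cor. 4.9
p. 423 ("For `N ≤ 4` and `ν ≥ 4`, the `U(N)`-model has chiral LRO at `m = 0`, for `N = 5` the same
is true for `ν ≥ 5`.  *Proof.* `K(N)` is calculated using Remark 4.6 and Lemma 4.7; `K(1) = 1`,
`K(2) = 2`, `K(3) = 10/3`, `K(4) = 5 + 8/15`, `K(5) < 7.4`.").

HOW IT IS TYPED.  Momenta `k ∈ Λ*` are the characters `χ : AddChar Λ ℂ` of the torus
(`χ_k(x) = e^{ikx}`), as in `InfraredBoundSpectralStep`; `cosSum χ = ∑_μ Re χ(e_μ) = C(k)`;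
`stagChar = e^{iπ̂·} = ε`; `twoPt N m a x y = [σ_xσ_y]_Λ` (unnormalised two-point kernel),
`twoPtHat = Re kernelSymbol twoPt = ∑_z [σ_0σ_z] Re χ(z)` (`= Z_Λ T̂_Λ(k)`, real); `latticeS ν L =
S_Λ(ν)`; `sgn`/`charge`/`ChiralInv` implement the chiral grading; `dimerK` the dimer cover (3.63);
`uNLogCoeff N k = w_k` of (4.27).  Normalised statements use `expect = [·]_Λ/Z_Λ` with `Z_Λ > 0`
proved (`partitionFunction_pos`).

## References

* M. Salmhofer, E. Seiler, *Proof of chiral symmetry breaking in strongly coupled lattice gauge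
  theory*, Commun. Math. Phys. 139 (1991) 395–432, (3.100)–(3.113), §4 (Def. 4.1, Remarks 4.5–4.6,
  Lemma 4.7, Thm. 4.8, Cor. 4.9, Remark 4.10). [SalmhoferSeiler1991]
* J. Fröhlich, B. Simon, T. Spencer, Commun. Math. Phys. 50 (1976) 79–95 (infrared bounds; the
  paper's [18]). [FrohlichSimonSpencer1976]
-/

noncomputable section

open MvPolynomial Finset

namespace Literature.MathematicalPhysics.StatisticalMechanics

open Literature.Probability.LatticeModels (TorusSite)

namespace ComplexSpin

variable {ν L : ℕ}

/-! ### Characters of the torus: `C(k) = ∑_μ cos k_μ`, the staggered character `e^{iπ̂x}` -/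

/-- `C(k) = ∑_μ cos k_μ` (4.1), for the character `χ = e^{ik·}` of the torus: `cos k_μ = Re χ(e_μ)`.
[cite: SalmhoferSeiler1991, (4.1)] -/
def cosSum (χ : AddChar (TorusSite ν L) ℂ) : ℝ :=
  ∑ μ : Fin ν, (χ (Pi.single μ 1)).re

/-- The symbol of `-Δ` is `2D(k) = 2(ν - C(k))` (3.110)/(4.1). [cite: SalmhoferSeiler1991, (3.110) and (4.1)] -/
theorem symbolRe_neg_one (χ : AddChar (TorusSite ν L) ℂ) :
    symbolRe (-1) χ = 2 * ((ν : ℝ) - cosSum χ) := by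
  unfold symbolRe cosSum
  rw [mul_sub, Finset.mul_sum, show (2 : ℝ) * ν = ∑ _μ : Fin ν, (2 : ℝ) by simp [mul_comm],
    ← Finset.sum_sub_distrib]
  refine Finset.sum_congr rfl fun μ _ => ?_
  ring

/-- The symbol of `Δ̄` is `2D(k + π̂) = 2(ν + C(k))`. [cite: SalmhoferSeiler1991, (3.112)] -/
theorem symbolRe_one (χ : AddChar (TorusSite ν L) ℂ) :
    symbolRe 1 χ = 2 * ((ν : ℝ) + cosSum χ) := by
  unfold symbolRe cosSum
  rw [mul_add, Finset.mul_sum, show (2 : ℝ) * ν = ∑ _μ : Fin ν, (2 : ℝ) by simp [mul_comm],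
    ← Finset.sum_add_distrib]
  refine Finset.sum_congr rfl fun μ _ => ?_
  ring

/-- **The staggered character** `x ↦ e^{iπ̂·x} = ε(x) = (-1)^{∑ x_μ}` of the even torus ((2.8),
(3.101)). [cite: SalmhoferSeiler1991, (2.8) and (3.101)] -/
def stagChar (hL : 2 ∣ L) : AddChar (TorusSite ν L) ℂ where
  toFun x := (-1 : ℂ) ^ (parity hL x).val
  map_zero_eq_one' := by simp [parity]
  map_add_eq_mul' x y := by
    have hp : parity hL (x + y) = parity hL x + parity hL y := by
      unfold parity
      rw [← Finset.sum_add_distrib]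
      exact Finset.sum_congr rfl fun j _ => by rw [Pi.add_apply, map_add]
    rw [hp, ← pow_add]
    rcases Nat.even_or_odd ((parity hL x).val + (parity hL y).val) with he | ho
    · rw [he.neg_one_pow]
      have : Even ((parity hL x + parity hL y).val) := by
        have h2 : ((parity hL x + parity hL y).val : ZMod 2) = ((parity hL x).val + (parity hL y).val : ℕ) := by
          rw [ZMod.natCast_zmod_val, Nat.cast_add, ZMod.natCast_zmod_val, ZMod.natCast_zmod_val]
        have := (ZMod.natCast_eq_natCast_iff' _ _ 2).mp h2
        rw [Nat.even_iff, this, ← Nat.even_iff]; exact he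
      rw [this.neg_one_pow]
    · rw [ho.neg_one_pow]
      have : Odd ((parity hL x + parity hL y).val) := by
        have h2 : ((parity hL x + parity hL y).val : ZMod 2) = ((parity hL x).val + (parity hL y).val : ℕ) := by
          rw [ZMod.natCast_zmod_val, Nat.cast_add, ZMod.natCast_zmod_val, ZMod.natCast_zmod_val]
        have := (ZMod.natCast_eq_natCast_iff' _ _ 2).mp h2
        rw [Nat.odd_iff, this, ← Nat.odd_iff]; exact ho
      rw [this.neg_one_pow]

/-- `ε(x) = 1` on even sites, `-1` on odd sites. [cite: SalmhoferSeiler1991, (2.8)] -/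
theorem stagChar_apply (hL : 2 ∣ L) (x : TorusSite ν L) :
    stagChar hL x = if parity hL x = 0 then 1 else -1 := by
  change (-1 : ℂ) ^ (parity hL x).val = _
  by_cases h : parity hL x = 0
  · rw [if_pos h, h, ZMod.val_zero, pow_zero]
  · rw [if_neg h]
    have : parity hL x = 1 := by
      have : ∀ a : ZMod 2, a ≠ 0 → a = 1 := by decide
      exact this _ h
    rw [this, ZMod.val_one, pow_one]

/-- `ε(e_μ) = -1`. [cite: SalmhoferSeiler1991, (2.8)] -/
theorem stagChar_single (hL : 2 ∣ L) (μ : Fin ν) :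
    stagChar (ν := ν) hL (Pi.single μ 1) = -1 := by
  rw [stagChar_apply]
  have : parity (ν := ν) hL (Pi.single μ 1) = 1 := by
    have := parity_add_single hL (0 : TorusSite ν L) μ
    rw [zero_add] at this
    rw [this]
    simp [parity]
  rw [this, if_neg (by decide)]

/-- `ε` is real: `ε(-x) = ε(x)`, `ε(x)² = 1`, i.e. `ε + ε = 0` in the character group. [cite: SalmhoferSeiler1991, (2.8)] -/
theorem stagChar_add_stagChar (hL : 2 ∣ L) : stagChar (ν := ν) hL + stagChar hL = 0 := by
  refine AddChar.ext _ _ fun x => ?_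
  rw [AddChar.add_apply, AddChar.zero_apply, stagChar_apply]
  split_ifs <;> norm_num

/-- `C(ε + χ) = -C(χ)` (`C(k + π̂) = -C(k)`, (4.14)). [cite: SalmhoferSeiler1991, (4.14)] -/
theorem cosSum_stagChar_add (hL : 2 ∣ L) (χ : AddChar (TorusSite ν L) ℂ) :
    cosSum (stagChar hL + χ) = -cosSum χ := by
  unfold cosSum
  rw [← Finset.sum_neg_distrib]
  refine Finset.sum_congr rfl fun μ _ => ?_
  rw [AddChar.add_apply, stagChar_single, neg_one_mul, Complex.neg_re]

variable [NeZero L]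

/-- `Pi.single μ c = c.val • e_μ` on the torus. [folklore] -/
private theorem single_eq_nsmul (μ : Fin ν) (c : ZMod L) :
    (Pi.single μ c : TorusSite ν L) = c.val • (Pi.single μ (1 : ZMod L) : TorusSite ν L) := by
  funext j
  rw [Pi.smul_apply]
  by_cases h : j = μ
  · subst h
    rw [Pi.single_eq_same, Pi.single_eq_same, nsmul_eq_mul, mul_one, ZMod.natCast_zmod_val]
  · rw [Pi.single_eq_of_ne h, Pi.single_eq_of_ne h, smul_zero]

/-- Two characters of the torus agreeing on the unit vectors `e_μ` are equal. [folklore] -/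
private theorem addChar_ext_single {χ ψ : AddChar (TorusSite ν L) ℂ}
    (h : ∀ μ : Fin ν, χ (Pi.single μ 1) = ψ (Pi.single μ 1)) : χ = ψ := by
  classical
  apply AddChar.toAddMonoidHomEquiv.injective
  refine AddMonoidHom.functions_ext _ _ _ fun μ c => ?_
  change χ (Pi.single μ c) = ψ (Pi.single μ c)
  rw [single_eq_nsmul μ c, AddChar.map_nsmul_eq_pow, AddChar.map_nsmul_eq_pow, h μ]

/-- A value of a character of a finite group on the unit circle with real part `1` is `1`. [folklore] -/
private theorem eq_one_of_re_eq_one {z : ℂ} (hz : ‖z‖ = 1) (hre : z.re = 1) : z = 1 := by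
  have h2 : z.re ^ 2 + z.im ^ 2 = 1 := by
    have := Complex.sq_norm z  -- ‖z‖^2 = normSq z
    rw [Complex.normSq_apply, hz] at this
    nlinarith [this]
  have him : z.im = 0 := by nlinarith
  exact Complex.ext (by simp [hre]) (by simp [him])

/-- `C(χ) ≤ ν`, with equality only for the trivial character (`k = 0`). [cite: SalmhoferSeiler1991, (4.1)–(4.2)] -/
theorem cosSum_le (χ : AddChar (TorusSite ν L) ℂ) : cosSum χ ≤ ν := by
  unfold cosSum
  calc ∑ μ : Fin ν, (χ (Pi.single μ 1)).re ≤ ∑ _μ : Fin ν, (1 : ℝ) :=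
        Finset.sum_le_sum fun μ _ => (Complex.re_le_norm _).trans (by rw [AddChar.norm_apply])
    _ = ν := by simp

/-- `C(χ) = ν` forces `χ = 0` (the constant character). [cite: SalmhoferSeiler1991, (4.1)–(4.2)] -/
theorem cosSum_lt_of_ne_zero {χ : AddChar (TorusSite ν L) ℂ} (hχ : χ ≠ 0) : cosSum χ < ν := by
  by_contra hlt
  have heq : cosSum χ = ν := le_antisymm (cosSum_le χ) (not_lt.mp hlt)
  apply hχ
  -- every term attains its maximum `1`
  have hall : ∀ μ : Fin ν, (χ (Pi.single μ 1)).re = 1 := by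
    intro μ₀
    by_contra hμ₀
    have hlt' : (χ (Pi.single μ₀ 1)).re < 1 :=
      lt_of_le_of_ne ((Complex.re_le_norm _).trans (by rw [AddChar.norm_apply])) hμ₀
    have : cosSum χ < ν := by
      unfold cosSum
      calc ∑ μ : Fin ν, (χ (Pi.single μ 1)).re < ∑ _μ : Fin ν, (1 : ℝ) :=
            Finset.sum_lt_sum (fun μ _ => (Complex.re_le_norm _).trans (by rw [AddChar.norm_apply]))
              ⟨μ₀, Finset.mem_univ _, hlt'⟩
        _ = ν := by simp
    linarith
  exact addChar_ext_single fun μ => by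
    rw [AddChar.zero_apply]
    exact eq_one_of_re_eq_one (AddChar.norm_apply _ _) (hall μ)

/-- `-ν ≤ C(χ)`. [cite: SalmhoferSeiler1991, (4.1)] -/
theorem neg_le_cosSum (χ : AddChar (TorusSite ν L) ℂ) : -(ν : ℝ) ≤ cosSum χ := by
  unfold cosSum
  calc -(ν : ℝ) = ∑ _μ : Fin ν, (-1 : ℝ) := by simp
    _ ≤ ∑ μ : Fin ν, (χ (Pi.single μ 1)).re :=
        Finset.sum_le_sum fun μ _ => (neg_le_of_abs_le ((Complex.abs_re_le_norm _).trans
          (by rw [AddChar.norm_apply])))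

/-- `C(χ) = -ν` forces `χ = ε` (even torus). [cite: SalmhoferSeiler1991, (4.14)] -/
theorem neg_lt_cosSum_of_ne_stagChar (hL : 2 ∣ L) {χ : AddChar (TorusSite ν L) ℂ}
    (hχ : χ ≠ stagChar hL) : -(ν : ℝ) < cosSum χ := by
  have h1 : stagChar hL + χ ≠ 0 := by
    intro h
    apply hχ
    have := congrArg (fun ψ => stagChar hL + ψ) h
    simp only [add_zero] at this
    rw [← add_assoc, stagChar_add_stagChar, zero_add] at this
    exact this
  have := cosSum_lt_of_ne_zero h1
  rw [cosSum_stagChar_add] at this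
  linarith

/-! ### The two-point kernel and its Fourier symbol; the infrared bound mode by mode (3.112)–(3.113) -/

/-- The (unnormalised) two-point function `G(x,y) = [σ_x σ_y]_Λ` as a kernel on the torus
(`T_Λ(x-y) Z_Λ` of (3.100)). [cite: SalmhoferSeiler1991, (3.100)] -/
def twoPt (N : ℕ) (m : ℝ) (a : ℕ → ℝ) (x y : TorusSite ν L) : ℝ :=
  bracket N m a (X x * X y)

/-- Its Fourier symbol `ĝ(χ) = ∑_z [σ_0σ_z] χ(z)` (real), i.e. `Z_Λ T̂_Λ(k)` of (3.105).
[cite: SalmhoferSeiler1991, (3.105)] -/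
def twoPtHat (N : ℕ) (m : ℝ) (a : ℕ → ℝ) (χ : AddChar (TorusSite ν L) ℂ) : ℝ :=
  (kernelSymbol (twoPt (ν := ν) (L := L) N m a) χ).re

/-- `G` is translation invariant. [cite: SalmhoferSeiler1991, (3.100)] -/
theorem twoPt_add (N : ℕ) (m : ℝ) (a : ℕ → ℝ) (x y c : TorusSite ν L) :
    twoPt N m a (x + c) (y + c) = twoPt N m a x y :=
  bracket_X_mul_X_add N m a x y c

/-- `G` is symmetric. [cite: SalmhoferSeiler1991, (3.100)] -/
theorem twoPt_comm (N : ℕ) (m : ℝ) (a : ℕ → ℝ) (x y : TorusSite ν L) :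
    twoPt N m a x y = twoPt N m a y x :=
  bracket_X_mul_X_comm N m a x y

/-- The symbol is real: `kernelSymbol G χ = ĝ(χ)`. [cite: SalmhoferSeiler1991, (3.105)] -/
theorem kernelSymbol_twoPt (N : ℕ) (m : ℝ) (a : ℕ → ℝ) (χ : AddChar (TorusSite ν L) ℂ) :
    kernelSymbol (twoPt (ν := ν) (L := L) N m a) χ = ((twoPtHat N m a χ : ℝ) : ℂ) :=
  (Complex.conj_eq_iff_re.1 (conj_kernelSymbol (twoPt_add N m a) (twoPt_comm N m a) χ)).symm

/-- **(3.112)–(3.113), first half**: `2 D(k) T̂_Λ(k) ≤ N⁻¹` mode by mode, unnormalised: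
`2(ν - C(χ)) ĝ(χ) ≤ Z_Λ/N` (Gaussian domination (3.98) to second order, diagonalised).
[cite: SalmhoferSeiler1991, (3.112)–(3.113)] -/
theorem twoPtHat_mode_le (hL : Even L) (i : Fin ν) (hcard : 2 ≤ Fintype.card (TorusSite ν L))
    {N : ℕ} (hN : 1 ≤ N) (m : ℝ) {a : ℕ → ℝ} (hb : ∀ k ≤ N, 0 ≤ fluctCoeff N a k)
    (χ : AddChar (TorusSite ν L) ℂ) :
    2 * ((ν : ℝ) - cosSum χ) * twoPtHat N m a χ ≤
      (1 / N) * partitionFunction (ν := ν) (L := L) N m a := by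
  have hZ0 : 0 ≤ partitionFunction (ν := ν) (L := L) N m a :=
    (partitionFunction_nonneg' hL i hcard 1 (Or.inl rfl) m hb).1
  have hκ : 0 ≤ 1 / (N : ℝ) * partitionFunction (ν := ν) (L := L) N m a := by positivity
  have hA : ∀ φ : TorusSite ν L → ℝ,
      ∑ x, ∑ y, stencil (-1) φ x * twoPt N m a x y * stencil (-1) φ y ≤
        (1 / (N : ℝ) * partitionFunction (ν := ν) (L := L) N m a) * ∑ x, φ x * stencil (-1) φ x := by
    intro φ
    have h1 := bracket_sq_field_stencil_negOne_le hL i hcard hN m hb φ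
    rw [sq, bracket_field_mul_field] at h1
    unfold twoPt
    linarith
  have h := symbolRe_mul_kernelSymbol_le (s := -1) (by norm_num) (twoPt_add N m a) (twoPt_comm N m a)
    hκ hA χ
  rw [symbolRe_neg_one] at h
  exact h

/-- **(3.112)–(3.113), second half**: `2 D(k+π̂) T̂_Λ(k) ≥ -N⁻¹` mode by mode, unnormalised:
`-2(ν + C(χ)) ĝ(χ) ≤ Z_Λ/N` ((3.99) to second order, diagonalised).
[cite: SalmhoferSeiler1991, (3.112)–(3.113)] -/
theorem neg_twoPtHat_mode_le (hL : Even L) (i : Fin ν) (hcard : 2 ≤ Fintype.card (TorusSite ν L))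
    {N : ℕ} (hN : 1 ≤ N) (m : ℝ) {a : ℕ → ℝ} (hb : ∀ k ≤ N, 0 ≤ fluctCoeff N a k)
    (χ : AddChar (TorusSite ν L) ℂ) :
    2 * ((ν : ℝ) + cosSum χ) * (-twoPtHat N m a χ) ≤
      (1 / N) * partitionFunction (ν := ν) (L := L) N m a := by
  have hZ0 : 0 ≤ partitionFunction (ν := ν) (L := L) N m a :=
    (partitionFunction_nonneg' hL i hcard 1 (Or.inl rfl) m hb).1
  have hκ : 0 ≤ 1 / (N : ℝ) * partitionFunction (ν := ν) (L := L) N m a := by positivity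
  set G' : TorusSite ν L → TorusSite ν L → ℝ := fun x y => -twoPt N m a x y with hG'
  have hT' : ∀ x y c : TorusSite ν L, G' (x + c) (y + c) = G' x y := fun x y c => by
    simp only [hG', twoPt_add]
  have hS' : ∀ x y : TorusSite ν L, G' x y = G' y x := fun x y => by
    simp only [hG', twoPt_comm N m a x y]
  have hA : ∀ φ : TorusSite ν L → ℝ,
      ∑ x, ∑ y, stencil 1 φ x * G' x y * stencil 1 φ y ≤
        (1 / (N : ℝ) * partitionFunction (ν := ν) (L := L) N m a) * ∑ x, φ x * stencil 1 φ x := by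
    intro φ
    have h1 := neg_le_bracket_sq_field_stencil_one hL i hcard hN m hb φ
    rw [sq, bracket_field_mul_field] at h1
    have : ∑ x, ∑ y, stencil 1 φ x * G' x y * stencil 1 φ y =
        -∑ x, ∑ y, stencil 1 φ x * bracket N m a (X x * X y) * stencil 1 φ y := by
      rw [← Finset.sum_neg_distrib]
      refine Finset.sum_congr rfl fun x _ => ?_
      rw [← Finset.sum_neg_distrib]
      exact Finset.sum_congr rfl fun y _ => by simp only [hG', twoPt]; ring
    rw [this]
    linarith
  have h := symbolRe_mul_kernelSymbol_le (s := 1) (by norm_num) hT' hS' hκ hA χ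
  have hsym : (kernelSymbol G' χ).re = -twoPtHat N m a χ := by
    simp only [hG', twoPtHat, kernelSymbol, Complex.ofReal_neg, neg_mul, Finset.sum_neg_distrib,
      Complex.neg_re]
  rw [symbolRe_one, hsym] at h
  exact h

/-! ### Fourier inversion for the nearest-neighbour sum -/

/-- **Fourier inversion**: `|Λ| G(0,ξ) = ∑_χ ĝ(χ) conj χ(ξ)` (3.104). [cite: SalmhoferSeiler1991, (3.104)–(3.105)] -/
theorem card_mul_twoPt_eq (N : ℕ) (m : ℝ) (a : ℕ → ℝ) (ξ : TorusSite ν L) :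
    (Fintype.card (TorusSite ν L) : ℂ) * ((twoPt N m a 0 ξ : ℝ) : ℂ) =
      ∑ χ : AddChar (TorusSite ν L) ℂ,
        kernelSymbol (twoPt (ν := ν) (L := L) N m a) χ * starRingEnd ℂ (χ ξ) := by
  classical
  unfold kernelSymbol
  simp_rw [Finset.sum_mul]
  rw [Finset.sum_comm]
  have : ∀ z : TorusSite ν L, ∑ χ : AddChar (TorusSite ν L) ℂ,
      ((twoPt N m a 0 z : ℝ) : ℂ) * χ z * starRingEnd ℂ (χ ξ) =
      ((twoPt N m a 0 z : ℝ) : ℂ) * (if z = ξ then (Fintype.card (TorusSite ν L) : ℂ) else 0) := by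
    intro z
    rw [← sum_addChar_mul_conj z ξ, Finset.mul_sum]
    exact Finset.sum_congr rfl fun χ _ => by ring
  simp_rw [this, mul_ite, mul_zero]
  rw [Finset.sum_ite_eq' Finset.univ ξ, if_pos (Finset.mem_univ ξ), mul_comm]

/-- **The nearest-neighbour sum through the symbol**:
`∑_μ (G(0,e_μ) + G(0,-e_μ)) = |Λ|⁻¹ ∑_χ ĝ(χ) · 2C(χ)` — `∑_{|ξ|=1} T(ξ) = 2∫ T̂(k) C(k)` of
(4.12)–(4.13)/(4.40) on the finite torus. [cite: SalmhoferSeiler1991, (4.12)–(4.13) and (4.40)] -/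
theorem sum_twoPt_nbr_eq (N : ℕ) (m : ℝ) (a : ℕ → ℝ) :
    ∑ μ : Fin ν, (twoPt N m a (0 : TorusSite ν L) (Pi.single μ 1) +
        twoPt N m a (0 : TorusSite ν L) (-Pi.single μ 1)) =
      (Fintype.card (TorusSite ν L) : ℝ)⁻¹ *
        ∑ χ : AddChar (TorusSite ν L) ℂ, twoPtHat N m a χ * (2 * cosSum χ) := by
  classical
  have hn : (Fintype.card (TorusSite ν L) : ℂ) ≠ 0 := Nat.cast_ne_zero.2 Fintype.card_ne_zero
  have key : (Fintype.card (TorusSite ν L) : ℂ) *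
      ∑ μ : Fin ν, (((twoPt N m a (0 : TorusSite ν L) (Pi.single μ 1) : ℝ) : ℂ) +
        ((twoPt N m a (0 : TorusSite ν L) (-Pi.single μ 1) : ℝ) : ℂ)) =
      ∑ χ : AddChar (TorusSite ν L) ℂ,
        ((twoPtHat N m a χ : ℝ) : ℂ) * (2 * ((cosSum χ : ℝ) : ℂ)) := by
    rw [Finset.mul_sum]
    simp_rw [mul_add, card_mul_twoPt_eq, ← Finset.sum_add_distrib]
    rw [Finset.sum_comm]
    refine Finset.sum_congr rfl fun χ _ => ?_
    simp_rw [← mul_add]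
    rw [← Finset.mul_sum, kernelSymbol_twoPt]
    congr 1
    rw [cosSum, Complex.ofReal_sum, Finset.mul_sum]
    refine Finset.sum_congr rfl fun μ _ => ?_
    rw [AddChar.map_neg_eq_conj, Complex.conj_conj, add_comm, Complex.add_conj]
    push_cast
    ring
  apply Complex.ofReal_injective
  push_cast
  rw [← key, ← mul_assoc, inv_mul_cancel₀ hn, one_mul]

/-! ### The lattice sum `S_Λ(ν)` of (4.3) and the finite-volume form of (4.14)/(4.40) -/

omit [NeZero L] in
/-- `C(0) = ν` (the constant character, `k = 0`). [cite: SalmhoferSeiler1991, (4.1)] -/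
theorem cosSum_zero : cosSum (0 : AddChar (TorusSite ν L) ℂ) = ν := by
  simp [cosSum]

omit [NeZero L] in
/-- `C(π̂) = -ν`. [cite: SalmhoferSeiler1991, (4.14)] -/
theorem cosSum_stagChar (hL : 2 ∣ L) : cosSum (stagChar (ν := ν) hL) = -(ν : ℝ) := by
  unfold cosSum
  simp_rw [stagChar_single]
  simp

omit [NeZero L] in
/-- For `ν ≥ 1` the staggered character is not the constant one. [cite: SalmhoferSeiler1991, (2.8)] -/
theorem stagChar_ne_zero (hL : 2 ∣ L) (hν : 1 ≤ ν) : stagChar (ν := ν) (L := L) hL ≠ 0 := by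
  intro h
  have := congrArg cosSum h
  rw [cosSum_stagChar, cosSum_zero] at this
  have hν' : (0 : ℝ) < ν := Nat.cast_pos.mpr hν
  linarith

/-- The integrand of `S(ν)` folded over `ℬ⁺` by `k ↦ k + π̂` ((4.3), (4.14)): as a function of
`c = C(k)`, `c/(ν-c)` for `c > 0`, `(-c)/(ν+c) = C(k+π̂)/D(k+π̂)` for `c < 0`, `0` for `c = 0`.
[cite: SalmhoferSeiler1991, (4.3) and (4.14)] -/
def modeTerm (ν : ℕ) (c : ℝ) : ℝ :=
  if 0 < c then c / (ν - c) else if c < 0 then -c / (ν + c) else 0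

/-- **Per mode**: for `k ∉ {0, π̂}`, `2 C(k) ĝ(k) ≤ (Z_Λ/N) · modeTerm(C(k))` — the infrared bound
(3.113)/(3.109) inserted into `2∫ T̂ C` "which can be applied because `C > 0` on `ℬ⁺`" (4.14).
[cite: SalmhoferSeiler1991, (4.14)] -/
theorem two_cosSum_mul_twoPtHat_le (hL : Even L) (i : Fin ν)
    (hcard : 2 ≤ Fintype.card (TorusSite ν L)) {N : ℕ} (hN : 1 ≤ N) (m : ℝ) {a : ℕ → ℝ}
    (hb : ∀ k ≤ N, 0 ≤ fluctCoeff N a k) {χ : AddChar (TorusSite ν L) ℂ} (h0 : χ ≠ 0)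
    (hε : χ ≠ stagChar hL.two_dvd) :
    2 * cosSum χ * twoPtHat N m a χ ≤
      (1 / N) * partitionFunction (ν := ν) (L := L) N m a * modeTerm ν (cosSum χ) := by
  set Z := partitionFunction (ν := ν) (L := L) N m a with hZ
  set c := cosSum χ with hc
  set g := twoPtHat N m a χ with hg
  have hZ0 : 0 ≤ Z := (partitionFunction_nonneg' hL i hcard 1 (Or.inl rfl) m hb).1
  have hNpos : (0 : ℝ) < N := Nat.cast_pos.mpr hN
  have hK : 0 ≤ 1 / (N : ℝ) * Z := by positivity
  have h1 := twoPtHat_mode_le hL i hcard hN m hb χ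
  have h2 := neg_twoPtHat_mode_le hL i hcard hN m hb χ
  rw [← hc, ← hg, ← hZ] at h1 h2
  unfold modeTerm
  rcases lt_trichotomy 0 c with hpos | hzero | hneg
  · rw [if_pos hpos]
    have hD : 0 < (ν : ℝ) - c := by have := cosSum_lt_of_ne_zero h0; rw [← hc] at this; linarith
    have hgle : g ≤ (1 / N * Z) / (2 * ((ν : ℝ) - c)) := by
      rw [le_div_iff₀ (by positivity)]; linarith
    calc 2 * c * g ≤ 2 * c * ((1 / N * Z) / (2 * ((ν : ℝ) - c))) :=
          mul_le_mul_of_nonneg_left hgle (by positivity)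
      _ = 1 / N * Z * (c / (ν - c)) := by field_simp
  · rw [← hzero]; simp
  · rw [if_neg (not_lt.mpr hneg.le), if_pos hneg]
    have hD : 0 < (ν : ℝ) + c := by
      have := neg_lt_cosSum_of_ne_stagChar hL.two_dvd hε; rw [← hc] at this; linarith
    have hgle : -g ≤ (1 / N * Z) / (2 * ((ν : ℝ) + c)) := by
      rw [le_div_iff₀ (by positivity)]; linarith
    calc 2 * c * g = 2 * (-c) * (-g) := by ring
      _ ≤ 2 * (-c) * ((1 / N * Z) / (2 * ((ν : ℝ) + c))) :=
          mul_le_mul_of_nonneg_left hgle (by linarith)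
      _ = 1 / N * Z * (-c / (ν + c)) := by field_simp

/-- **The lattice sum `S_Λ(ν)`**: the Riemann sum of (4.3) on the dual torus,
`S_Λ(ν) = |Λ|⁻¹ ∑_{k ∈ Λ* ∖ {0}, C(k) > 0} C(k)/D(k)`, `D = ν - C` (4.1) — the finite-volume
quantity that (4.14)/(4.40) produce before the thermodynamic limit `Λ* → ℬ_ν` replaces it by
`S(ν) = ∫_{ℬ⁺} d^νk/(2π)^ν C(k)/D(k)`. [cite: SalmhoferSeiler1991, (4.3) and (4.14)] -/
def latticeS (ν L : ℕ) [NeZero L] : ℝ :=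
  (Fintype.card (TorusSite ν L) : ℝ)⁻¹ *
    ∑ χ ∈ (Finset.univ : Finset (AddChar (TorusSite ν L) ℂ)).filter
      (fun χ => χ ≠ 0 ∧ 0 < cosSum χ), cosSum χ / (ν - cosSum χ)

/-- **`ℬ⁺ + π̂ = ℬ ∖ ℬ⁺`**: folding the modes with `C < 0` onto those with `C > 0` by `k ↦ k + π̂`,
`∑_{k ∉ {0,π̂}} modeTerm(C(k)) = 2 ∑_{k ≠ 0, C(k) > 0} C(k)/D(k) = 2 |Λ| S_Λ(ν)` (4.14).
[cite: SalmhoferSeiler1991, (4.14)] -/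
theorem sum_modeTerm_eq (hL : 2 ∣ L) :
    ∑ χ : AddChar (TorusSite ν L) ℂ,
        (if χ = 0 ∨ χ = stagChar hL then 0 else modeTerm ν (cosSum χ)) =
      2 * ((Fintype.card (TorusSite ν L) : ℝ) * latticeS ν L) := by
  classical
  set ε := stagChar (ν := ν) hL with hεdef
  -- the positive and the negative part
  set pos : AddChar (TorusSite ν L) ℂ → ℝ := fun χ =>
    if χ = 0 ∨ χ = ε then 0 else if 0 < cosSum χ then cosSum χ / (ν - cosSum χ) else 0 with hpos
  set neg : AddChar (TorusSite ν L) ℂ → ℝ := fun χ =>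
    if χ = 0 ∨ χ = ε then 0 else if cosSum χ < 0 then -cosSum χ / (ν + cosSum χ) else 0 with hneg
  have hsplit : ∀ χ : AddChar (TorusSite ν L) ℂ,
      (if χ = 0 ∨ χ = ε then 0 else modeTerm ν (cosSum χ)) = pos χ + neg χ := by
    intro χ
    simp only [hpos, hneg, modeTerm]
    by_cases h : χ = 0 ∨ χ = ε
    · simp [h]
    · rw [if_neg h, if_neg h, if_neg h]
      rcases lt_trichotomy 0 (cosSum χ) with h1 | h2 | h3
      · simp [h1, not_lt.mpr h1.le]
      · rw [← h2]; simp
      · simp [h3, not_lt.mpr h3.le]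
  -- `neg χ = pos (ε + χ)`
  have hshift : ∀ χ : AddChar (TorusSite ν L) ℂ, neg χ = pos (ε + χ) := by
    intro χ
    simp only [hpos, hneg]
    have hC : cosSum (ε + χ) = -cosSum χ := cosSum_stagChar_add hL χ
    have hiff : (ε + χ = 0 ∨ ε + χ = ε) ↔ (χ = 0 ∨ χ = ε) := by
      constructor
      · rintro (h | h)
        · right
          have := congrArg (fun ψ => ε + ψ) h
          simp only [add_zero] at this
          rw [← add_assoc, hεdef, stagChar_add_stagChar, zero_add] at this
          exact this
        · left; exact add_eq_left.mp h
      · rintro (h | h)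
        · right; rw [h, add_zero]
        · left; rw [h, hεdef, stagChar_add_stagChar]
    by_cases h : χ = 0 ∨ χ = ε
    · rw [if_pos h, if_pos (hiff.mpr h)]
    · rw [if_neg h, if_neg (fun h' => h (hiff.mp h')), hC]
      simp only [neg_pos, sub_neg_eq_add]
  simp_rw [hsplit]
  rw [Finset.sum_add_distrib]
  have hsum_neg : ∑ χ, neg χ = ∑ χ, pos χ := by
    simp_rw [hshift]
    exact Fintype.sum_equiv (Equiv.addLeft ε) _ _ fun χ => rfl
  rw [hsum_neg, ← two_mul, latticeS,
    mul_inv_cancel_left₀ (Nat.cast_ne_zero.2 Fintype.card_ne_zero : (Fintype.card (TorusSite ν L) : ℝ) ≠ 0),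
    Finset.sum_filter]
  congr 1
  refine Finset.sum_congr rfl fun χ _ => ?_
  simp only [hpos]
  by_cases h0 : χ = 0
  · simp [h0]
  · by_cases hE : χ = ε
    · have hc : ¬ (0 < cosSum χ) := by
        rw [hE, hεdef, cosSum_stagChar]
        have : (0 : ℝ) ≤ ν := Nat.cast_nonneg ν
        linarith
      rw [if_pos (Or.inr hE), if_neg (fun h => hc h.2)]
    · simp [h0, hE]

/-- **(4.40) in finite volume** (the infrared form of `∑_{|y-x|=1} ⟨σ_xσ_y⟩`, unnormalised): on the
even torus `(ℤ/Lℤ)^ν` (`ν ≥ 1`) with `b_k ≥ 0`,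
`∑_μ ([σ_0σ_{e_μ}] + [σ_0σ_{-e_μ}]) ≤ (2ν/|Λ|) (ĝ(0) - ĝ(π̂)) + (2/N) Z_Λ S_Λ(ν)`,
where `ĝ(0) = ∑_x [σ_0σ_x]`, `-ĝ(π̂) = -∑_x ε(x)[σ_0σ_x]` are `|Λ| Z_Λ` times the weights `c_0`,
`c_π̂` of the modes `k = 0`, `k = π̂` (3.108), and `S_Λ(ν)` is the lattice sum of (4.3).
[cite: SalmhoferSeiler1991, (4.40) with (3.108)–(3.113) and (4.14)] -/
theorem sum_twoPt_nbr_le (hν : 1 ≤ ν) (hL : Even L) {N : ℕ} (hN : 1 ≤ N) (m : ℝ) {a : ℕ → ℝ}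
    (hb : ∀ k ≤ N, 0 ≤ fluctCoeff N a k) :
    ∑ μ : Fin ν, (twoPt N m a (0 : TorusSite ν L) (Pi.single μ 1) +
        twoPt N m a (0 : TorusSite ν L) (-Pi.single μ 1)) ≤
      2 * ν / (Fintype.card (TorusSite ν L) : ℝ) *
          (twoPtHat N m a (0 : AddChar (TorusSite ν L) ℂ) -
            twoPtHat N m a (stagChar (ν := ν) hL.two_dvd)) +
        (2 / N) * partitionFunction (ν := ν) (L := L) N m a * latticeS ν L := by
  classical
  set i : Fin ν := ⟨0, hν⟩
  have hcard : 2 ≤ Fintype.card (TorusSite ν L) := by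
    rw [Fintype.card_fun, ZMod.card, Fintype.card_fin]
    have hL2 : 2 ≤ L := by
      obtain ⟨k, hk⟩ := hL
      have : L ≠ 0 := NeZero.ne L
      omega
    calc 2 ≤ L := hL2
      _ ≤ L ^ ν := Nat.le_self_pow (by omega) L
  set ε := stagChar (ν := ν) (L := L) hL.two_dvd with hεdef
  set Z := partitionFunction (ν := ν) (L := L) N m a with hZ
  set f : AddChar (TorusSite ν L) ℂ → ℝ := fun χ => twoPtHat N m a χ * (2 * cosSum χ) with hf
  set t : AddChar (TorusSite ν L) ℂ → ℝ := fun χ =>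
    if χ = 0 ∨ χ = ε then 0 else modeTerm ν (cosSum χ) with ht
  have hε0 : ε ≠ 0 := stagChar_ne_zero hL.two_dvd hν
  have hn : (0 : ℝ) < Fintype.card (TorusSite ν L) := Nat.cast_pos.2 Fintype.card_pos
  -- pointwise: `f χ ≤ (Z/N) t χ` off `{0, ε}`
  have hpt : ∀ χ ∈ (Finset.univ.erase (0 : AddChar (TorusSite ν L) ℂ)).erase ε,
      f χ ≤ 1 / N * Z * t χ := by
    intro χ hχ
    have hE : χ ≠ ε := Finset.ne_of_mem_erase hχ
    have h0 : χ ≠ 0 := Finset.ne_of_mem_erase (Finset.mem_of_mem_erase hχ)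
    simp only [hf, ht, if_neg (not_or.mpr ⟨h0, hE⟩)]
    have := two_cosSum_mul_twoPtHat_le hL i hcard hN m hb h0 hE
    linarith [this]
  -- split off the modes `0` and `ε`
  have hsumf : ∑ χ, f χ = f 0 + f ε + ∑ χ ∈ (Finset.univ.erase 0).erase ε, f χ := by
    rw [← Finset.add_sum_erase _ _ (Finset.mem_univ (0 : AddChar (TorusSite ν L) ℂ)),
      ← Finset.add_sum_erase _ _ (Finset.mem_erase.mpr ⟨hε0, Finset.mem_univ ε⟩), add_assoc]
  have hsumt : ∑ χ, t χ = ∑ χ ∈ (Finset.univ.erase 0).erase ε, t χ := by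
    rw [← Finset.add_sum_erase _ _ (Finset.mem_univ (0 : AddChar (TorusSite ν L) ℂ)),
      ← Finset.add_sum_erase _ _ (Finset.mem_erase.mpr ⟨hε0, Finset.mem_univ ε⟩)]
    simp [ht]
  have hrest : ∑ χ ∈ (Finset.univ.erase 0).erase ε, f χ ≤
      1 / N * Z * ∑ χ ∈ (Finset.univ.erase 0).erase ε, t χ := by
    rw [Finset.mul_sum]
    exact Finset.sum_le_sum hpt
  have ht_eq : ∑ χ, t χ = 2 * ((Fintype.card (TorusSite ν L) : ℝ) * latticeS ν L) :=
    sum_modeTerm_eq hL.two_dvd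
  have hf0 : f 0 = twoPtHat N m a (0 : AddChar (TorusSite ν L) ℂ) * (2 * ν) := by
    simp only [hf, cosSum_zero]
  have hfε : f ε = twoPtHat N m a ε * (2 * (-(ν : ℝ))) := by
    simp only [hf, hεdef, cosSum_stagChar]
  rw [sum_twoPt_nbr_eq, hsumf, hf0, hfε]
  rw [← hsumt, ht_eq] at hrest
  rw [inv_mul_le_iff₀ hn]
  have hcalc : (Fintype.card (TorusSite ν L) : ℝ) *
      (2 * ν / (Fintype.card (TorusSite ν L) : ℝ) *
          (twoPtHat N m a (0 : AddChar (TorusSite ν L) ℂ) - twoPtHat N m a ε) +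
        2 / N * Z * latticeS ν L) =
      twoPtHat N m a (0 : AddChar (TorusSite ν L) ℂ) * (2 * ν) +
          twoPtHat N m a ε * (2 * -(ν : ℝ)) +
        1 / N * Z * (2 * ((Fintype.card (TorusSite ν L) : ℝ) * latticeS ν L)) := by
    field_simp
    ring
  rw [hcalc]
  linarith [hrest]

/-! ### Chiral symmetry at `m = 0`: `⟨σ_0 σ_x⟩_Λ = 0` for `ε(x) = 1` ((3.101), (3.106)) -/

omit [NeZero L] in
/-- At `m = 0` the site weight is trivial: `F = e^{0} = 1`. [cite: SalmhoferSeiler1991, (3.101)] -/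
theorem siteWeight_zero_mass (N : ℕ) (x : TorusSite ν L) : siteWeight N 0 x = 1 := by
  unfold siteWeight
  rw [Finset.sum_range_succ']
  simp

/-- The staggered sign `ε(x) = ±1` as an integer. [cite: SalmhoferSeiler1991, (2.8)] -/
def sgn (hL : 2 ∣ L) (x : TorusSite ν L) : ℤ :=
  if parity hL x = 0 then 1 else -1

omit [NeZero L] in
/-- `ε(x + e_μ) = -ε(x)`. [cite: SalmhoferSeiler1991, (2.8)] -/
theorem sgn_add_single (hL : 2 ∣ L) (x : TorusSite ν L) (μ : Fin ν) :
    sgn hL (x + Pi.single μ 1) = -sgn hL x := by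
  unfold sgn
  rw [parity_add_single]
  have h : ∀ a : ZMod 2, (if a + 1 = 0 then (1 : ℤ) else -1) = -(if a = 0 then 1 else -1) := by
    decide
  exact h _

/-- **The chiral charge** of a multi-index `L`: `∑_x ε(x) L_x` — the weight of `σ^L` under the
chiral rotation `σ_x ↦ e^{iαε(x)} σ_x` which is a symmetry at `m = 0`. [cite: SalmhoferSeiler1991, (3.101)] -/
def charge (hL : 2 ∣ L) (d : TorusSite ν L →₀ ℕ) : ℤ :=
  ∑ x : TorusSite ν L, sgn hL x * (d x : ℤ)

/-- The charge is additive. [cite: SalmhoferSeiler1991, (3.101)] -/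
theorem charge_add (hL : 2 ∣ L) (d₁ d₂ : TorusSite ν L →₀ ℕ) :
    charge hL (d₁ + d₂) = charge hL d₁ + charge hL d₂ := by
  unfold charge
  rw [← Finset.sum_add_distrib]
  refine Finset.sum_congr rfl fun x _ => ?_
  rw [Finsupp.add_apply]
  push_cast
  ring

/-- `charge(k·δ_x) = k ε(x)`. [cite: SalmhoferSeiler1991, (3.101)] -/
theorem charge_single (hL : 2 ∣ L) (x : TorusSite ν L) (k : ℕ) :
    charge hL (Finsupp.single x k) = sgn hL x * k := by
  classical
  unfold charge
  rw [Finset.sum_eq_single x]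
  · rw [Finsupp.single_eq_same]
  · intro y _ hy
    rw [Finsupp.single_eq_of_ne hy, Nat.cast_zero, mul_zero]
  · intro h
    exact absurd (Finset.mem_univ x) h

/-- All monomials of `p` have chiral charge `0` (chiral invariance). [cite: SalmhoferSeiler1991, (3.101)] -/
def ChiralInv (hL : 2 ∣ L) (p : MvPolynomial (TorusSite ν L) ℝ) : Prop :=
  ∀ d, coeff d p ≠ 0 → charge hL d = 0

/-- Constants are chirally invariant. [cite: SalmhoferSeiler1991, (3.101)] -/
theorem ChiralInv.C (hL : 2 ∣ L) (c : ℝ) : ChiralInv hL (C c : MvPolynomial (TorusSite ν L) ℝ) := by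
  classical
  intro d hd
  rw [coeff_C] at hd
  by_cases h : 0 = d
  · rw [← h]; simp [charge]
  · exact (hd (if_neg h)).elim

/-- Products of chirally invariant polynomials are chirally invariant. [cite: SalmhoferSeiler1991, (3.101)] -/
theorem ChiralInv.mul (hL : 2 ∣ L) {p q : MvPolynomial (TorusSite ν L) ℝ} (hp : ChiralInv hL p)
    (hq : ChiralInv hL q) : ChiralInv hL (p * q) := by
  classical
  intro d hd
  rw [coeff_mul] at hd
  obtain ⟨x, hx, hne⟩ := Finset.exists_ne_zero_of_sum_ne_zero hd
  have h1 : coeff x.1 p ≠ 0 := fun h => hne (by rw [h, zero_mul])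
  have h2 : coeff x.2 q ≠ 0 := fun h => hne (by rw [h, mul_zero])
  have hx' : x.1 + x.2 = d := by simpa [Finset.mem_antidiagonal] using hx
  rw [← hx', charge_add, hp x.1 h1, hq x.2 h2, add_zero]

/-- Finite products of chirally invariant polynomials are chirally invariant. [cite: SalmhoferSeiler1991, (3.101)] -/
theorem ChiralInv.prod (hL : 2 ∣ L) {ι : Type*} (s : Finset ι)
    {f : ι → MvPolynomial (TorusSite ν L) ℝ} (h : ∀ i ∈ s, ChiralInv hL (f i)) :
    ChiralInv hL (∏ i ∈ s, f i) := by
  classical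
  induction s using Finset.induction_on with
  | empty => rw [Finset.prod_empty, ← C_1]; exact ChiralInv.C hL 1
  | @insert b s hb ih =>
    rw [Finset.prod_insert hb]
    exact (h b (Finset.mem_insert_self b s)).mul hL (ih fun i hi => h i (Finset.mem_insert_of_mem hi))

/-- The bond weight is chirally invariant: `(σ_xσ_{x+e_μ})^k` has charge `k(ε(x) + ε(x+e_μ)) = 0`.
[cite: SalmhoferSeiler1991, (3.101)] -/
theorem chiralInv_bondWeight (hL : 2 ∣ L) (N : ℕ) (a : ℕ → ℝ) (x : TorusSite ν L) (μ : Fin ν) :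
    ChiralInv hL (bondWeight N a x (x + Pi.single μ 1)) := by
  classical
  intro d hd
  unfold bondWeight at hd
  rw [coeff_sum] at hd
  obtain ⟨k, _, hk⟩ := Finset.exists_ne_zero_of_sum_ne_zero hd
  have hm : (X x * X (x + Pi.single μ 1) : MvPolynomial (TorusSite ν L) ℝ) ^ k =
      monomial (Finsupp.single x k + Finsupp.single (x + Pi.single μ 1) k) 1 := by
    rw [mul_pow, X_pow_eq_monomial, X_pow_eq_monomial, monomial_mul, mul_one]
  rw [hm, C_mul_monomial, coeff_monomial] at hk
  by_cases he : Finsupp.single x k + Finsupp.single (x + Pi.single μ 1) k = d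
  · rw [← he, charge_add, charge_single, charge_single, sgn_add_single]
    ring
  · exact (hk (if_neg he)).elim

/-- **Equal numbers of even and odd sites**: `∑_x ε(x) = 0` on the even torus of positive dimension
(`x ↦ x + e_1` exchanges `Λ_e` and `Λ_o`). [cite: SalmhoferSeiler1991, (3.93)] -/
theorem sum_sgn_eq_zero (hL : 2 ∣ L) (hν : 1 ≤ ν) : ∑ x : TorusSite ν L, sgn hL x = 0 := by
  set i : Fin ν := ⟨0, hν⟩
  have h := Equiv.sum_comp (Equiv.addRight (Pi.single i (1 : ZMod L)))
    (fun x : TorusSite ν L => sgn hL x)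
  simp only [Equiv.coe_addRight, sgn_add_single, Finset.sum_neg_distrib] at h
  linarith

/-- The top multi-index `∏_x σ_x^N` has charge `N ∑_x ε(x) = 0`. [cite: SalmhoferSeiler1991, (3.101)] -/
theorem charge_topExponent (hL : 2 ∣ L) (hν : 1 ≤ ν) (N : ℕ) :
    charge hL (topExponent (ν := ν) (L := L) N) = 0 := by
  unfold charge
  simp_rw [topExponent_apply']
  rw [← Finset.sum_mul, sum_sgn_eq_zero hL hν, zero_mul]

/-- **Chiral selection rule**: at `m = 0`, an observable all of whose monomials carry nonzero
chiral charge has `[Φ]_Λ = 0` — "because of chiral symmetry, `⟨σ_0σ_x⟩_Λ = 0` if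
`ε(x)ε(0) = 1`" (3.101). [cite: SalmhoferSeiler1991, (3.101)] -/
theorem bracket_zero_mass_eq_zero_of_charge (hL : 2 ∣ L) (hν : 1 ≤ ν) (N : ℕ) (a : ℕ → ℝ)
    {Φ : MvPolynomial (TorusSite ν L) ℝ} (hΦ : ∀ d, coeff d Φ ≠ 0 → charge hL d ≠ 0) :
    bracket N 0 a Φ = 0 := by
  classical
  have hB : ChiralInv hL (boltzmann (ν := ν) (L := L) N 0 a) := by
    unfold boltzmann
    simp_rw [siteWeight_zero_mass]
    rw [Finset.prod_const_one, one_mul]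
    exact ChiralInv.prod hL _ fun x _ => ChiralInv.prod hL _ fun μ _ => chiralInv_bondWeight hL N a x μ
  unfold bracket
  by_contra hne
  rw [coeff_mul] at hne
  obtain ⟨x, hx, hne'⟩ := Finset.exists_ne_zero_of_sum_ne_zero hne
  have h1 : coeff x.1 Φ ≠ 0 := fun h => hne' (by rw [h, zero_mul])
  have h2 : coeff x.2 (boltzmann N 0 a) ≠ 0 := fun h => hne' (by rw [h, mul_zero])
  have hx' : x.1 + x.2 = topExponent N := by simpa [Finset.mem_antidiagonal] using hx
  have := charge_topExponent (ν := ν) (L := L) hL hν N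
  rw [← hx', charge_add, hB x.2 h2, add_zero] at this
  exact hΦ x.1 h1 this

omit [NeZero L] in
/-- `ε(0) = 1`. [cite: SalmhoferSeiler1991, (2.8)] -/
theorem sgn_zero (hL : 2 ∣ L) : sgn hL (0 : TorusSite ν L) = 1 := by
  simp [sgn, parity]

/-- **(3.101)**: at `m = 0`, `[σ_0 σ_x]_Λ = 0` whenever `ε(x) = ε(0) = 1` (including `x = 0`).
[cite: SalmhoferSeiler1991, (3.101)] -/
theorem twoPt_zero_mass_eq_zero (hL : 2 ∣ L) (hν : 1 ≤ ν) (N : ℕ) (a : ℕ → ℝ)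
    {x : TorusSite ν L} (hx : parity hL x = 0) : twoPt N 0 a 0 x = 0 := by
  classical
  unfold twoPt
  refine bracket_zero_mass_eq_zero_of_charge hL hν N a fun d hd => ?_
  have hm : (X (0 : TorusSite ν L) * X x : MvPolynomial (TorusSite ν L) ℝ) =
      monomial (Finsupp.single 0 1 + Finsupp.single x 1) 1 := by
    rw [X, X, monomial_mul, mul_one]
  rw [hm, coeff_monomial] at hd
  by_cases he : Finsupp.single (0 : TorusSite ν L) 1 + Finsupp.single x 1 = d
  · rw [← he, charge_add, charge_single, charge_single, sgn_zero]
    have : sgn hL x = 1 := by simp [sgn, hx]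
    rw [this]
    norm_num
  · exact (hd (if_neg he)).elim

/-- **(3.106)**: at `m = 0`, `T̂_Λ(k + π̂) = -T̂_Λ(k)`; in particular `ĝ(π̂) = -ĝ(0)` (`c_0 = c_π̂`,
used in (4.41)). [cite: SalmhoferSeiler1991, (3.106) and (4.41)] -/
theorem twoPtHat_stagChar_zero_mass (hL : 2 ∣ L) (hν : 1 ≤ ν) (N : ℕ) (a : ℕ → ℝ) :
    twoPtHat N 0 a (stagChar (ν := ν) (L := L) hL) =
      -twoPtHat N 0 a (0 : AddChar (TorusSite ν L) ℂ) := by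
  unfold twoPtHat kernelSymbol
  rw [← Complex.neg_re, ← Finset.sum_neg_distrib, Complex.re_sum, Complex.re_sum]
  refine Finset.sum_congr rfl fun z _ => ?_
  rw [AddChar.zero_apply, mul_one, stagChar_apply]
  by_cases hz : parity hL z = 0
  · rw [twoPt_zero_mass_eq_zero hL hν N a hz]; simp
  · rw [if_neg hz]; simp

/-! ### `Z_Λ > 0`: a dimer configuration has positive weight (Def. 3.1 requires `Z ≠ 0`) -/

omit [NeZero L] in
/-- For polynomials with nonnegative coefficients, one term of the Cauchy product bounds the
coefficient of the product from below. [cite: SalmhoferSeiler1991, proof of Thm. 3.18(1) (nonnegative weights)] -/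
theorem NonnegCoeff.mul_coeff_le {p q : MvPolynomial (TorusSite ν L) ℝ} (hp : NonnegCoeff p)
    (hq : NonnegCoeff q) (d₁ d₂ : TorusSite ν L →₀ ℕ) :
    coeff d₁ p * coeff d₂ q ≤ coeff (d₁ + d₂) (p * q) := by
  classical
  rw [coeff_mul]
  have hmem : (d₁, d₂) ∈ HasAntidiagonal.antidiagonal (d₁ + d₂) := by
    rw [HasAntidiagonal.mem_antidiagonal]
  exact Finset.single_le_sum (f := fun x : (TorusSite ν L →₀ ℕ) × (TorusSite ν L →₀ ℕ) =>
    coeff x.1 p * coeff x.2 q) (fun x _ => mul_nonneg (hp x.1) (hq x.2)) hmem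

omit [NeZero L] in
/-- The same for finite products: `∏ coeff_{d_i}(f_i) ≤ coeff_{∑ d_i}(∏ f_i)`.
[cite: SalmhoferSeiler1991, proof of Thm. 3.18(1) (nonnegative weights)] -/
theorem NonnegCoeff.prod_coeff_le {ι : Type*} (s : Finset ι)
    {f : ι → MvPolynomial (TorusSite ν L) ℝ} (hf : ∀ i ∈ s, NonnegCoeff (f i))
    (d : ι → TorusSite ν L →₀ ℕ) :
    ∏ i ∈ s, coeff (d i) (f i) ≤ coeff (∑ i ∈ s, d i) (∏ i ∈ s, f i) := by
  classical
  induction s using Finset.induction_on with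
  | empty => simp
  | @insert b s hb ih =>
    rw [Finset.prod_insert hb, Finset.sum_insert hb, Finset.prod_insert hb]
    have hfb : NonnegCoeff (f b) := hf b (Finset.mem_insert_self b s)
    have hfs : ∀ i ∈ s, NonnegCoeff (f i) := fun i hi => hf i (Finset.mem_insert_of_mem hi)
    calc coeff (d b) (f b) * ∏ i ∈ s, coeff (d i) (f i)
        ≤ coeff (d b) (f b) * coeff (∑ i ∈ s, d i) (∏ i ∈ s, f i) :=
          mul_le_mul_of_nonneg_left (ih hfs) (hfb _)
      _ ≤ coeff (d b + ∑ i ∈ s, d i) (f b * ∏ i ∈ s, f i) :=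
          hfb.mul_coeff_le (NonnegCoeff.prod s hfs) _ _

omit [NeZero L] in
/-- `F(0) = 1`: the constant coefficient of the site weight. [cite: SalmhoferSeiler1991, Def. 3.1] -/
theorem coeff_zero_siteWeight (N : ℕ) (m : ℝ) (x : TorusSite ν L) :
    coeff 0 (siteWeight N m x) = 1 := by
  classical
  unfold siteWeight
  rw [coeff_sum, Finset.sum_range_succ']
  have h0 : ∀ j ∈ range N, coeff (0 : TorusSite ν L →₀ ℕ)
      (C ((2 * N * m) ^ (j + 1) / (Nat.factorial (j + 1) : ℝ)) * X x ^ (j + 1)) = 0 := by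
    intro j _
    rw [coeff_C_mul, coeff_X_pow, if_neg, mul_zero]
    intro h
    have := Finsupp.ext_iff.mp h x
    simp at this
  rw [Finset.sum_eq_zero h0]
  simp

omit [NeZero L] in
/-- The coefficient of `(σ_xσ_y)^k` in `B(σ_xσ_y)` is `a_k` (`x ≠ y`, `k ≤ N`).
[cite: SalmhoferSeiler1991, Def. 3.1] -/
theorem coeff_bondWeight_diag {N : ℕ} (a : ℕ → ℝ) {x y : TorusSite ν L} (hxy : x ≠ y) {k : ℕ}
    (hk : k ≤ N) :
    coeff (Finsupp.single x k + Finsupp.single y k) (bondWeight N a x y) = a k := by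
  classical
  have hm : ∀ j : ℕ, (X x * X y : MvPolynomial (TorusSite ν L) ℝ) ^ j =
      monomial (Finsupp.single x j + Finsupp.single y j) 1 := by
    intro j
    rw [mul_pow, X_pow_eq_monomial, X_pow_eq_monomial, monomial_mul, mul_one]
  unfold bondWeight
  rw [coeff_sum, Finset.sum_eq_single k]
  · rw [hm k, C_mul_monomial, coeff_monomial, if_pos rfl, mul_one]
  · intro j _ hj
    rw [hm j, C_mul_monomial, coeff_monomial, if_neg]
    intro h
    apply hj
    have := Finsupp.ext_iff.mp h x
    simpa [Finsupp.single_apply, hxy.symm] using this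
  · intro h
    exact absurd (Finset.mem_range.mpr (Nat.lt_succ_of_le hk)) h

/-- The dimer cover of the even torus along the first axis: weight `N` on the links `(x, x+e_1)`
with `x_1` even, `0` elsewhere ((3.63): `Λ = ⋃ {x, x+e_1}`). [cite: SalmhoferSeiler1991, (3.63)] -/
def dimerK (hL : 2 ∣ L) (i₀ : Fin ν) (N : ℕ) (l : TorusSite ν L × Fin ν) : ℕ :=
  if l.2 = i₀ ∧ ZMod.castHom hL (ZMod 2) (l.1 i₀) = 0 then N else 0

/-- Every site is covered exactly once, with multiplicity `N`: the dimer exponents add up to the top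
exponent `∏_x σ_x^N`. [cite: SalmhoferSeiler1991, (3.63)] -/
theorem sum_dimer_eq_topExponent (hL : 2 ∣ L) (i₀ : Fin ν) (N : ℕ) :
    ∑ l : TorusSite ν L × Fin ν,
        (Finsupp.single l.1 (dimerK hL i₀ N l) + Finsupp.single (l.1 + Pi.single l.2 1) (dimerK hL i₀ N l)) =
      topExponent (ν := ν) (L := L) N := by
  classical
  ext z
  rw [topExponent_apply', Finsupp.finsetSum_apply]
  simp_rw [Finsupp.add_apply, Finset.sum_add_distrib, Fintype.sum_prod_type]
  have hA : ∑ x : TorusSite ν L, ∑ μ : Fin ν, (Finsupp.single x (dimerK hL i₀ N (x, μ))) z =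
      dimerK hL i₀ N (z, i₀) := by
    rw [Finset.sum_comm]
    simp_rw [Finsupp.single_apply]
    have : ∀ μ : Fin ν, ∑ x : TorusSite ν L, (if x = z then dimerK hL i₀ N (x, μ) else 0) =
        dimerK hL i₀ N (z, μ) := fun μ => by
      rw [Finset.sum_ite_eq' Finset.univ z, if_pos (Finset.mem_univ z)]
    simp_rw [this]
    rw [Finset.sum_eq_single i₀]
    · intro μ _ hμ; simp [dimerK, hμ]
    · intro h; exact absurd (Finset.mem_univ _) h
  have hB : ∑ x : TorusSite ν L, ∑ μ : Fin ν,
      (Finsupp.single (x + Pi.single μ 1) (dimerK hL i₀ N (x, μ))) z =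
      dimerK hL i₀ N (z - Pi.single i₀ 1, i₀) := by
    rw [Finset.sum_comm]
    simp_rw [Finsupp.single_apply]
    have : ∀ μ : Fin ν, ∑ x : TorusSite ν L,
        (if x + Pi.single μ 1 = z then dimerK hL i₀ N (x, μ) else 0) =
        dimerK hL i₀ N (z - Pi.single μ 1, μ) := fun μ => by
      rw [Finset.sum_eq_single (z - Pi.single μ 1)]
      · rw [if_pos (sub_add_cancel z _)]
      · intro x _ hx
        rw [if_neg]
        intro h
        exact hx (by rw [← h, add_sub_cancel_right])
      · intro h; exact absurd (Finset.mem_univ _) h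
    simp_rw [this]
    rw [Finset.sum_eq_single i₀]
    · intro μ _ hμ; simp [dimerK, hμ]
    · intro h; exact absurd (Finset.mem_univ _) h
  rw [hA, hB]
  simp only [dimerK, true_and, Pi.sub_apply, Pi.single_eq_same, map_sub, map_one]
  have key : ∀ c : ZMod 2, (if c = 0 then N else 0) + (if c - 1 = 0 then N else 0) = N := by
    intro c
    rcases (by decide : ∀ c : ZMod 2, c = 0 ∨ c = 1) c with h | h
    · subst h; simp
    · subst h; simp
  exact key _

/-- **`Z_Λ > 0`** on the even torus of positive dimension and side `≥ 2`, for `m ≥ 0`, `a_k ≥ 0`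
(`k ≤ N`), `a_0, a_N > 0`: the dimer configuration (3.63) contributes `a_N^{|Λ|/2} > 0` and all
other contributions are `≥ 0` (Def. 3.1 asks `Z_G ≠ 0`; Thm. 3.18(1)).
[cite: SalmhoferSeiler1991, Def. 3.1 and Thm. 3.18(1)] -/
theorem partitionFunction_pos (hL : 2 ∣ L) (hL2 : 2 ≤ L) (hν : 1 ≤ ν) {N : ℕ} {m : ℝ} (hm : 0 ≤ m)
    {a : ℕ → ℝ} (ha : ∀ k ≤ N, 0 ≤ a k) (ha0 : 0 < a 0) (haN : 0 < a N) :
    0 < partitionFunction (ν := ν) (L := L) N m a := by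
  classical
  set i₀ : Fin ν := ⟨0, hν⟩
  set d : TorusSite ν L × Fin ν → TorusSite ν L →₀ ℕ := fun l =>
    Finsupp.single l.1 (dimerK hL i₀ N l) + Finsupp.single (l.1 + Pi.single l.2 1) (dimerK hL i₀ N l)
    with hd
  have hbonds : (∏ x : TorusSite ν L, ∏ μ : Fin ν, bondWeight N a x (x + Pi.single μ 1)) =
      ∏ l : TorusSite ν L × Fin ν, bondWeight N a l.1 (l.1 + Pi.single l.2 1) := by
    rw [Fintype.prod_prod_type]
  have hS : NonnegCoeff (∏ x : TorusSite ν L, siteWeight N m x) :=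
    NonnegCoeff.prod _ fun x _ => nonnegCoeff_siteWeight N hm x
  have hB : NonnegCoeff (∏ l : TorusSite ν L × Fin ν, bondWeight N a l.1 (l.1 + Pi.single l.2 1)) :=
    NonnegCoeff.prod _ fun l _ => nonnegCoeff_bondWeight N ha _ _
  -- sites: constant coefficient `1`
  have h1 : (1 : ℝ) ≤ coeff 0 (∏ x : TorusSite ν L, siteWeight N m x) := by
    have := NonnegCoeff.prod_coeff_le (Finset.univ : Finset (TorusSite ν L))
      (fun x _ => nonnegCoeff_siteWeight N hm x) (fun _ => (0 : TorusSite ν L →₀ ℕ))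
    simp_rw [coeff_zero_siteWeight, Finset.prod_const_one, Finset.sum_const_zero] at this
    exact this
  -- bonds: the dimer configuration
  have h2 : ∏ l : TorusSite ν L × Fin ν, a (dimerK hL i₀ N l) ≤
      coeff (topExponent N) (∏ l : TorusSite ν L × Fin ν, bondWeight N a l.1 (l.1 + Pi.single l.2 1)) := by
    have := NonnegCoeff.prod_coeff_le (Finset.univ : Finset (TorusSite ν L × Fin ν))
      (fun l _ => nonnegCoeff_bondWeight N ha l.1 (l.1 + Pi.single l.2 1)) d
    rw [hd, sum_dimer_eq_topExponent hL i₀ N] at this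
    refine le_trans (le_of_eq ?_) this
    refine Finset.prod_congr rfl fun l _ => ?_
    have hne : l.1 ≠ l.1 + Pi.single l.2 1 := by
      haveI : Fact (1 < L) := ⟨hL2⟩
      intro h
      have h1 : (Pi.single l.2 (1 : ZMod L) : TorusSite ν L) = 0 := by
        have := congrArg (fun y => y - l.1) h
        simp only [sub_self, add_sub_cancel_left] at this
        exact this.symm
      have := congrFun h1 l.2
      simp at this
    have hk : dimerK hL i₀ N l ≤ N := by unfold dimerK; split_ifs <;> omega
    rw [coeff_bondWeight_diag a hne hk]
  have h3 : 0 < ∏ l : TorusSite ν L × Fin ν, a (dimerK hL i₀ N l) := by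
    refine Finset.prod_pos fun l _ => ?_
    unfold dimerK
    split_ifs
    · exact haN
    · exact ha0
  have h4 := hS.mul_coeff_le hB 0 (topExponent N)
  rw [zero_add] at h4
  rw [partitionFunction, bracket, one_mul, boltzmann, hbonds]
  calc (0 : ℝ) < 1 * ∏ l : TorusSite ν L × Fin ν, a (dimerK hL i₀ N l) := by rw [one_mul]; exact h3
    _ ≤ coeff 0 (∏ x : TorusSite ν L, siteWeight N m x) *
          coeff (topExponent N) (∏ l : TorusSite ν L × Fin ν, bondWeight N a l.1 (l.1 + Pi.single l.2 1)) :=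
        mul_le_mul h1 h2 h3.le (zero_le_one.trans h1)
    _ ≤ _ := h4

/-! ### `w_k ≥ 0 ⇒ b_k ≥ 0`: `e^{NV} = e^{N(W - t)}` has nonnegative Taylor coefficients -/

/-- Truncated generating polynomial `∑_{i ≤ N} f_i X^i` (univariate). [folklore] -/
private def uniP (N : ℕ) (f : ℕ → ℝ) : Polynomial ℝ :=
  ∑ i ∈ range (N + 1), Polynomial.C (f i) * Polynomial.X ^ i

/-- Its coefficients. [folklore] -/
private theorem coeff_uniP (N : ℕ) (f : ℕ → ℝ) (k : ℕ) :
    (uniP N f).coeff k = if k < N + 1 then f k else 0 := by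
  unfold uniP
  rw [Polynomial.finsetSum_coeff]
  simp_rw [Polynomial.coeff_C_mul_X_pow]
  rw [Finset.sum_ite_eq (range (N + 1)) k]
  simp only [Finset.mem_range]

/-- Coefficients below `N+1` of a multiple of `X^{N+1}` vanish. [folklore] -/
private theorem coeff_eq_zero_of_X_pow_dvd {N : ℕ} {P : Polynomial ℝ}
    (h : Polynomial.X ^ (N + 1) ∣ P) {k : ℕ} (hk : k ≤ N) : P.coeff k = 0 :=
  (Polynomial.X_pow_dvd_iff.mp h) k (Nat.lt_succ_of_le hk)

/-- `k · coeff_k(P Q) = coeff_k(D_P Q) + coeff_k(P D_Q)` where `D` multiplies the `i`-th coefficient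
by `i` (Leibniz rule for `X d/dX` in coefficient form). [folklore] -/
private theorem mul_coeff_mul_eq (N : ℕ) (f g : ℕ → ℝ) (k : ℕ) :
    (k : ℝ) * (uniP N f * uniP N g).coeff k =
      (uniP N (fun i => (i : ℝ) * f i) * uniP N g).coeff k +
        (uniP N f * uniP N (fun j => (j : ℝ) * g j)).coeff k := by
  rw [Polynomial.coeff_mul, Polynomial.coeff_mul, Polynomial.coeff_mul, Finset.mul_sum,
    ← Finset.sum_add_distrib]
  refine Finset.sum_congr rfl fun p hp => ?_
  have hpk : p.1 + p.2 = k := HasAntidiagonal.mem_antidiagonal.mp hp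
  simp only [coeff_uniP]
  have hk : (k : ℝ) = p.1 + p.2 := by rw [← hpk]; push_cast; ring
  rw [hk]
  split_ifs <;> ring

/-- Truncated Taylor data of `e^{-Nt}`. [folklore] -/
private def expNeg (N : ℕ) (j : ℕ) : ℝ := (-(N : ℝ)) ^ j / (Nat.factorial j : ℝ)

/-- `X^{N+1} ∣ X (e^{-Nt})'_{≤N} + N X (e^{-Nt})_{≤N}`: `j e_j = -N e_{j-1}`. [folklore] -/
private theorem X_pow_dvd_expNeg (N : ℕ) :
    Polynomial.X ^ (N + 1) ∣
      uniP N (fun j => (j : ℝ) * expNeg N j) + Polynomial.C (N : ℝ) * Polynomial.X * uniP N (expNeg N) := by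
  rw [Polynomial.X_pow_dvd_iff]
  intro d hd
  rw [Polynomial.coeff_add, coeff_uniP, if_pos hd, mul_assoc, Polynomial.coeff_C_mul]
  rcases Nat.eq_zero_or_pos d with rfl | hd1
  · simp
  · obtain ⟨d', rfl⟩ := Nat.exists_eq_add_of_le hd1
    rw [show 1 + d' = d' + 1 by ring, Polynomial.coeff_X_mul, coeff_uniP, if_pos (by omega)]
    simp only [expNeg, Nat.factorial_succ, Nat.cast_mul, pow_succ]
    have h1 : ((Nat.factorial d' : ℕ) : ℝ) ≠ 0 := by positivity
    have h2 : ((d' + 1 : ℕ) : ℝ) ≠ 0 := by positivity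
    field_simp
    ring

/-- The Cauchy product of the truncations reproduces `b_k = fluctCoeff N a k` up to degree `N`
(`e^{NV} = B(t) e^{-Nt}`, (3.73)). [cite: SalmhoferSeiler1991, (3.73)] -/
private theorem coeff_mul_expNeg_eq_fluctCoeff (N : ℕ) (a : ℕ → ℝ) {k : ℕ} (hk : k ≤ N) :
    (uniP N a * uniP N (expNeg N)).coeff k = fluctCoeff N a k := by
  rw [Polynomial.coeff_mul, Finset.Nat.sum_antidiagonal_eq_sum_range_succ_mk, fluctCoeff]
  refine Finset.sum_congr rfl fun j hj => ?_
  have hj' : j ≤ k := Nat.lt_succ_iff.mp (Finset.mem_range.mp hj)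
  rw [coeff_uniP, coeff_uniP, if_pos (by omega), if_pos (by omega), expNeg]
  ring

/-- **`e^{NV} = exp(N(W - t))` to order `N`**: the Taylor data `b = fluctCoeff N a` of `e^{NV}`
satisfy `HasLog N b w'` with `w'_1 = w_1 - 1 = 0` and `w'_k = w_k` otherwise — `V = W - t`
((3.73), proof of Remark 4.5). [cite: SalmhoferSeiler1991, (3.73) and Remark 4.5] -/
theorem hasLog_fluctCoeff {N : ℕ} {a w : ℕ → ℝ} (hlog : HasLog N a w) (hw1 : w 1 = 1) :
    HasLog N (fluctCoeff N a) (fun k => if k = 1 then 0 else w k) := by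
  intro k hk1 hkN
  -- abbreviations
  set A := uniP N a with hA
  set E := uniP N (expNeg N) with hE
  set Ω := uniP N (fun j => (j : ℝ) * w j) with hΩ
  set DA := uniP N (fun i => (i : ℝ) * a i) with hDA
  set DE := uniP N (fun j => (j : ℝ) * expNeg N j) with hDE
  -- (1) Leibniz
  have h1 := mul_coeff_mul_eq N a (expNeg N) k
  rw [← hA, ← hE, ← hDA, ← hDE] at h1
  -- (2) `DA ≡ C N Ω A`
  obtain ⟨Q, hQ⟩ := (show Polynomial.X ^ (N + 1) ∣ Polynomial.C (N : ℝ) * Ω * A - DA from by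
    rw [hΩ, hA, hDA]
    -- this is `X_pow_dvd_of_hasLog` of the SD file, re-derived (that lemma is private there)
    rw [Polynomial.X_pow_dvd_iff]
    intro d hd
    rw [Polynomial.coeff_sub, mul_assoc, Polynomial.coeff_C_mul, Polynomial.coeff_mul,
      coeff_uniP, if_pos hd]
    have h1 : ∑ p ∈ HasAntidiagonal.antidiagonal d,
        (uniP N (fun j => (j : ℝ) * w j)).coeff p.1 * (uniP N a).coeff p.2 =
        ∑ p ∈ HasAntidiagonal.antidiagonal d, (p.1 : ℝ) * w p.1 * a p.2 := by
      refine Finset.sum_congr rfl fun p hp => ?_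
      have hp' : p.1 + p.2 = d := HasAntidiagonal.mem_antidiagonal.mp hp
      rw [coeff_uniP, coeff_uniP, if_pos (by omega), if_pos (by omega)]
    rw [h1]
    rcases Nat.eq_zero_or_pos d with rfl | hd1
    · rw [Finset.Nat.antidiagonal_zero, Finset.sum_singleton]
      simp
    · rw [← hlog d hd1 (by omega), sub_self])
  have h2 : (DA * E).coeff k = (Polynomial.C (N : ℝ) * Ω * A * E).coeff k := by
    have : Polynomial.X ^ (N + 1) ∣ Polynomial.C (N : ℝ) * Ω * A * E - DA * E :=
      ⟨Q * E, by rw [← sub_mul, hQ]; ring⟩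
    have := coeff_eq_zero_of_X_pow_dvd this hkN
    rw [Polynomial.coeff_sub] at this
    linarith
  -- (3) `DE ≡ -C N X E`
  obtain ⟨R, hR⟩ := X_pow_dvd_expNeg N
  rw [← hDE, ← hE] at hR
  have h3 : (A * DE).coeff k = -((Polynomial.C (N : ℝ) * (Polynomial.X * (A * E))).coeff k) := by
    have : Polynomial.X ^ (N + 1) ∣ A * DE + Polynomial.C (N : ℝ) * (Polynomial.X * (A * E)) :=
      ⟨A * R, by rw [show A * DE + Polynomial.C (N : ℝ) * (Polynomial.X * (A * E)) =
        A * (DE + Polynomial.C (N : ℝ) * Polynomial.X * E) by ring, hR]; ring⟩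
    have := coeff_eq_zero_of_X_pow_dvd this hkN
    rw [Polynomial.coeff_add] at this
    linarith
  -- (4) coefficients of `X · (A E)` and of `Ω · (A E)`
  obtain ⟨k', rfl⟩ := Nat.exists_eq_add_of_le hk1
  rw [show 1 + k' = k' + 1 by ring] at h1 h2 h3 hkN ⊢
  have h4 : (Polynomial.C (N : ℝ) * (Polynomial.X * (A * E))).coeff (k' + 1) =
      N * (A * E).coeff k' := by
    rw [Polynomial.coeff_C_mul, Polynomial.coeff_X_mul]
  have h5 : (Polynomial.C (N : ℝ) * Ω * A * E).coeff (k' + 1) =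
      N * ∑ p ∈ HasAntidiagonal.antidiagonal (k' + 1), Ω.coeff p.1 * (A * E).coeff p.2 := by
    rw [mul_assoc, mul_assoc, Polynomial.coeff_C_mul, Polynomial.coeff_mul]
  -- (5) assemble: `(k'+1) b_{k'+1} = N ∑ (Ω_i - [i=1]) b_j`
  rw [h2, h3, h4, h5] at h1
  -- translate `(A E).coeff j` into `fluctCoeff N a j` for `j ≤ k'+1 ≤ N`
  rw [coeff_mul_expNeg_eq_fluctCoeff N a hkN] at h1
  rw [h1]
  -- split off the `i = 1` term on the right-hand side of `HasLog`
  have hmem : ((1, k') : ℕ × ℕ) ∈ HasAntidiagonal.antidiagonal (k' + 1) := by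
    rw [HasAntidiagonal.mem_antidiagonal]; ring
  rw [← Finset.add_sum_erase _ _ hmem, ← Finset.add_sum_erase _ (fun p : ℕ × ℕ =>
    (p.1 : ℝ) * (if p.1 = 1 then 0 else w p.1) * fluctCoeff N a p.2) hmem]
  simp only [if_true, mul_zero, zero_mul, zero_add, Nat.cast_one]
  rw [coeff_mul_expNeg_eq_fluctCoeff N a (by omega : k' ≤ N)]
  have hrest : ∑ p ∈ (HasAntidiagonal.antidiagonal (k' + 1)).erase (1, k'),
      Ω.coeff p.1 * (A * E).coeff p.2 =
      ∑ p ∈ (HasAntidiagonal.antidiagonal (k' + 1)).erase (1, k'),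
        (p.1 : ℝ) * (if p.1 = 1 then 0 else w p.1) * fluctCoeff N a p.2 := by
    refine Finset.sum_congr rfl fun p hp => ?_
    have hp' : p.1 + p.2 = k' + 1 :=
      HasAntidiagonal.mem_antidiagonal.mp (Finset.mem_of_mem_erase hp)
    have hne : p ≠ (1, k') := Finset.ne_of_mem_erase hp
    have hp1 : p.1 ≠ 1 := by
      intro h
      apply hne
      ext
      · exact h
      · simp only; omega
    rw [hΩ, coeff_uniP, if_pos (by omega), if_neg hp1,
      coeff_mul_expNeg_eq_fluctCoeff N a (by omega : p.2 ≤ N)]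
  rw [hrest, hΩ, coeff_uniP, if_pos (by omega), Nat.cast_one, one_mul, hw1]
  ring

/-- **`w_k ≥ 0 ⇒ b_k ≥ 0`** (the hypothesis of the infrared bound, Thm. 3.21, from that of Thm. 4.8):
if `B = exp(NW)` to order `N` with `w₁ = 1` and `w_k ≥ 0` (`2 ≤ k ≤ N`), then the Taylor
coefficients `b_k` of `e^{NV}`, `V = W - t`, are `≥ 0` for `k ≤ N` ("Theorem 3.23 applies", proof
of Thm. 4.8; cf. Remark 4.5). [cite: SalmhoferSeiler1991, Thm. 4.8 (proof) and Remark 4.5] -/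
theorem fluctCoeff_nonneg_of_hasLog {N : ℕ} {a w : ℕ → ℝ} (hlog : HasLog N a w) (ha0 : a 0 = 1)
    (hw1 : w 1 = 1) (hw : ∀ k, 2 ≤ k → k ≤ N → 0 ≤ w k) : ∀ k ≤ N, 0 ≤ fluctCoeff N a k := by
  have hb0 : fluctCoeff N a 0 = 1 := by simp [fluctCoeff, ha0]
  refine (hasLog_fluctCoeff hlog hw1).coeff_nonneg hb0 fun k hk1 hkN => ?_
  by_cases h : k = 1
  · simp [h]
  · rw [if_neg h]; exact hw k (by omega) hkN

/-! ### Chiral long-range order in finite volume: (4.38) + (4.40) ⇒ (4.41)–(4.42) -/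

/-- `∑_{|y|=1} [σ_0σ_y]` written with the neighbour enumeration of the SD file equals
`∑_μ (G(0,e_μ) + G(0,-e_μ))`. [cite: SalmhoferSeiler1991, (4.38)–(4.40)] -/
theorem sum_bracket_nbr_zero (N : ℕ) (m : ℝ) (a : ℕ → ℝ) :
    ∑ s : Fin ν × Bool, bracket N m a (X (0 : TorusSite ν L) * X (nbr 0 s)) =
      ∑ μ : Fin ν, (twoPt N m a (0 : TorusSite ν L) (Pi.single μ 1) +
        twoPt N m a (0 : TorusSite ν L) (-Pi.single μ 1)) := by
  rw [Fintype.sum_prod_type]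
  refine Finset.sum_congr rfl fun μ _ => ?_
  rw [Fintype.sum_bool]
  simp [nbr, twoPt]

/-- `α_k ≥ 0` for `k ≤ N`. [cite: SalmhoferSeiler1991, (4.29)] -/
theorem sdAlpha_nonneg {N : ℕ} (hN : 1 ≤ N) {w : ℕ → ℝ} (hw : ∀ k, 2 ≤ k → k ≤ N → 0 ≤ w k)
    {k : ℕ} (hk : k ≤ N) : 0 ≤ sdAlpha N w k := by
  unfold sdAlpha
  have hNpos : (0 : ℝ) < N := Nat.cast_pos.mpr hN
  refine div_nonneg (Finset.prod_nonneg fun i hi => ?_) ?_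
  · have hi' := Finset.mem_range.mp hi
    rw [sub_nonneg, div_le_one hNpos]
    exact_mod_cast (show i + 1 ≤ N by omega)
  · have : 0 ≤ ∑ i ∈ range (k - 2), ((i + 2 : ℕ) : ℝ) * w (i + 2) * sdProd N k (i + 1) := by
      refine Finset.sum_nonneg fun i hi => ?_
      have hi' := Finset.mem_range.mp hi
      exact mul_nonneg (mul_nonneg (Nat.cast_nonneg _) (hw (i + 2) (by omega) (by omega)))
        (sdProd_nonneg hN hk)
    linarith

/-- `K(N) ≥ 1 > 0` (the `k = 1` term is `w₁ α₁ = 1`). [cite: SalmhoferSeiler1991, (4.39)] -/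
theorem one_le_sdK {N : ℕ} (hN : 1 ≤ N) {w : ℕ → ℝ} (hw1 : w 1 = 1)
    (hw : ∀ k, 2 ≤ k → k ≤ N → 0 ≤ w k) : 1 ≤ sdK N w := by
  unfold sdK
  have h1 : (1 : ℕ) ∈ range (N + 1) := Finset.mem_range.mpr (by omega)
  have hterm : ∀ k ∈ range (N + 1), 0 ≤ (k : ℝ) * w k * sdAlpha N w k := by
    intro k hk
    have hkN : k ≤ N := Nat.lt_succ_iff.mp (Finset.mem_range.mp hk)
    rcases Nat.lt_or_ge k 2 with hk2 | hk2
    · interval_cases k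
      · simp
      · rw [hw1, sdAlpha_one]; norm_num
    · exact mul_nonneg (mul_nonneg (Nat.cast_nonneg k) (hw k hk2 hkN)) (sdAlpha_nonneg hN hw hkN)
  have := Finset.single_le_sum hterm h1
  rw [Nat.cast_one, hw1, sdAlpha_one] at this
  linarith

/-- **Chiral long-range order in finite volume, unnormalised (4.41)–(4.42).**  Complex spin system on
the even torus `Λ = (ℤ/Lℤ)^ν` (`ν ≥ 1`, `L ≥ 2` even) at `m = 0` with `B = exp(NW)` to order `N`,
`w₁ = 1`, `w_k ≥ 0` (Thm. 4.8's hypotheses; `b_k ≥ 0` for Thm. 3.21 follows,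
`fluctCoeff_nonneg_of_hasLog`).  Then
`|Λ|⁻¹ ∑_x [σ_0 σ_x]_Λ ≥ (Z_Λ/4ν) (1/K(N) - 2 S_Λ(ν)/N)`: the SD lower bound (4.38)
`Z ≤ K(N) ∑_{|y|=1}[σ_0σ_y]`, the infrared form (4.40) of the right side, and `c_0 = c_π̂` at `m = 0`
(3.106) combine to (4.41) `1 ≤ K(N)(4ν c_0 + 2S(ν)/N)`, here with the finite-volume
`c_0^Λ = |Λ|⁻¹∑_x⟨σ_0σ_x⟩_Λ` and the lattice sum `S_Λ(ν)` in place of their thermodynamic limits.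
[cite: SalmhoferSeiler1991, Thm. 4.8 ((4.38)–(4.42))] -/
theorem chiralLRO_bracket (hν : 1 ≤ ν) (hL : Even L) (hL2 : 2 ≤ L) {N : ℕ} (hN : 1 ≤ N)
    {a w : ℕ → ℝ} (hlog : HasLog N a w) (ha0 : a 0 = 1) (hw1 : w 1 = 1)
    (hw : ∀ k, 2 ≤ k → k ≤ N → 0 ≤ w k) :
    partitionFunction (ν := ν) (L := L) N 0 a / (4 * ν) * (1 / sdK N w - 2 * latticeS ν L / N) ≤
      (Fintype.card (TorusSite ν L) : ℝ)⁻¹ *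
        ∑ x : TorusSite ν L, bracket N 0 a (X (0 : TorusSite ν L) * X x) := by
  set Z := partitionFunction (ν := ν) (L := L) N 0 a with hZ
  set K := sdK N w with hK
  set S := latticeS ν L with hS
  set n : ℝ := (Fintype.card (TorusSite ν L) : ℝ) with hn
  set g0 := ∑ x : TorusSite ν L, bracket N 0 a (X (0 : TorusSite ν L) * X x) with hg0
  have hNpos : (0 : ℝ) < N := Nat.cast_pos.mpr hN
  have hνpos : (0 : ℝ) < ν := Nat.cast_pos.mpr hν
  have hnpos : 0 < n := Nat.cast_pos.2 Fintype.card_pos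
  have hK1 : 1 ≤ K := one_le_sdK hN hw1 hw
  have hKpos : 0 < K := by linarith
  have hw' : ∀ k, 1 ≤ k → k ≤ N → 0 ≤ w k := by
    intro k hk1 hkN
    rcases Nat.lt_or_ge k 2 with hk | hk
    · rw [show k = 1 by omega, hw1]; exact zero_le_one
    · exact hw k hk hkN
  have hZ0 : 0 ≤ Z := partitionFunction_nonneg_of_coeff N le_rfl (hlog.coeff_nonneg ha0 hw')
  have hb : ∀ k ≤ N, 0 ≤ fluctCoeff N a k := fluctCoeff_nonneg_of_hasLog hlog ha0 hw1 hw
  -- (4.38) at `m = 0`, `x = 0`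
  have h38 := partitionFunction_le_sd hN hlog ha0 hw1 hw hL2 (le_refl (0 : ℝ)) (0 : TorusSite ν L)
  rw [mul_zero, zero_mul, zero_add, sum_bracket_nbr_zero] at h38
  -- (4.40) and `ĝ(π̂) = -ĝ(0)`
  have h40 := sum_twoPt_nbr_le hν hL hN 0 hb
  rw [twoPtHat_stagChar_zero_mass hL.two_dvd hν, sub_neg_eq_add] at h40
  have hg : twoPtHat N 0 a (0 : AddChar (TorusSite ν L) ℂ) = g0 := by
    simp [twoPtHat, kernelSymbol, twoPt, hg0, Complex.re_sum]
  rw [hg, ← hZ, ← hS, ← hn] at h40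
  -- combine: `Z ≤ K (4ν g0 / n + 2 Z S / N)`
  have hcomb : Z ≤ K * (2 * ν / n * (g0 + g0) + 2 / N * Z * S) :=
    h38.trans (mul_le_mul_of_nonneg_left h40 hKpos.le)
  -- rearrange
  rw [div_mul_eq_mul_div, div_le_iff₀ (by positivity : (0 : ℝ) < 4 * ν)]
  have h1 : Z * (1 / K - 2 * S / N) = (Z - K * (2 / N * Z * S)) / K := by
    field_simp
  rw [h1, div_le_iff₀ hKpos]
  have h2 : K * (2 * ν / n * (g0 + g0)) = n⁻¹ * g0 * (4 * ν) * K := by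
    field_simp
    ring
  nlinarith [hcomb, h2]

/-- **Chiral long-range order in finite volume (4.42), normalised.**  Under the hypotheses of
`chiralLRO_bracket`: `|Λ|⁻¹ ∑_x ⟨σ_0 σ_x⟩_Λ ≥ (1/4ν)(1/K(N) - 2 S_Λ(ν)/N)` at `m = 0` — the uniform
lower bound behind `c_0 ≥ (1/4ν)(1/K(N) - 2S(ν)/N) > 0` (4.42) (printed with a misprinted
`min{0, ·}`), with the lattice sum `S_Λ(ν)` of (4.3) in place of `S(ν)`; `Z_Λ > 0` by the dimer
configuration. [cite: SalmhoferSeiler1991, Thm. 4.8 ((4.41)–(4.42))] -/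
theorem chiralLRO_expect (hν : 1 ≤ ν) (hL : Even L) (hL2 : 2 ≤ L) {N : ℕ} (hN : 1 ≤ N)
    {a w : ℕ → ℝ} (hlog : HasLog N a w) (ha0 : a 0 = 1) (hw1 : w 1 = 1)
    (hw : ∀ k, 2 ≤ k → k ≤ N → 0 ≤ w k) :
    1 / (4 * ν) * (1 / sdK N w - 2 * latticeS ν L / N) ≤
      (Fintype.card (TorusSite ν L) : ℝ)⁻¹ *
        ∑ x : TorusSite ν L, expect N 0 a (X (0 : TorusSite ν L) * X x) := by
  have hw' : ∀ k, 1 ≤ k → k ≤ N → 0 ≤ w k := by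
    intro k hk1 hkN
    rcases Nat.lt_or_ge k 2 with hk | hk
    · rw [show k = 1 by omega, hw1]; exact zero_le_one
    · exact hw k hk hkN
  have ha := hlog.coeff_nonneg ha0 hw'
  have hapos := hlog.coeff_pos hN ha0 hw1 hw
  have hZ : 0 < partitionFunction (ν := ν) (L := L) N 0 a :=
    partitionFunction_pos hL.two_dvd hL2 hν le_rfl ha (hapos 0 (Nat.zero_le N)) (hapos N le_rfl)
  have h := chiralLRO_bracket hν hL hL2 hN hlog ha0 hw1 hw
  simp_rw [expect_eq_div, div_eq_mul_inv]
  rw [← Finset.sum_mul]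
  have hνpos : (0 : ℝ) < ν := Nat.cast_pos.mpr hν
  rw [← mul_le_mul_iff_of_pos_right hZ]
  calc 1 / (4 * ν) * (1 / sdK N w - 2 * latticeS ν L / N) * partitionFunction N 0 a
      = partitionFunction N 0 a / (4 * ν) * (1 / sdK N w - 2 * latticeS ν L / N) := by ring
    _ ≤ (Fintype.card (TorusSite ν L) : ℝ)⁻¹ *
          ∑ x : TorusSite ν L, bracket N 0 a (X (0 : TorusSite ν L) * X x) := h
    _ = (Fintype.card (TorusSite ν L) : ℝ)⁻¹ *
          ((∑ x : TorusSite ν L, bracket N 0 a (X (0 : TorusSite ν L) * X x)) *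
            (partitionFunction N 0 a)⁻¹) * partitionFunction N 0 a := by
        field_simp

/-! ### The `U(N)` model, `N ≤ 4`: Remark 4.6 and the constants of Corollary 4.9 -/

/-- **Remark 4.6 (4.27)**: the Taylor coefficients `w_1,…,w_5` of `W = N⁻¹ log B` for the `U(N)`
model, as printed (`w₁ = 1`, `w₂ = N/(2(N-1))`, `w₃ = 2N²/(3(N-1)(N-2))`,
`w₄ = (5N-6)N³/(4(N-1)²(N-2)(N-3))`, `w₅ = 2N⁴(5N-12)/(5(N-1)²(N-2)(N-3)(N-4))`); only
`w_k`, `k ≤ N`, enter (Remark 3.2) and the formula for `w_k` is meaningful for `N ≥ k` (for `N < k`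
the printed denominator vanishes and Lean's value is the junk `x/0 = 0`, never used); `w_k := 0`
for `k = 0` and `k ≥ 6` (not printed; irrelevant for `N ≤ 5`). [cite: SalmhoferSeiler1991, Remark 4.6 (4.27)] -/
def uNLogCoeff (N : ℕ) : ℕ → ℝ
  | 1 => 1
  | 2 => (N : ℝ) / (2 * ((N : ℝ) - 1))
  | 3 => 2 * (N : ℝ) ^ 2 / (3 * ((N : ℝ) - 1) * ((N : ℝ) - 2))
  | 4 => (5 * (N : ℝ) - 6) * (N : ℝ) ^ 3 / (4 * ((N : ℝ) - 1) ^ 2 * ((N : ℝ) - 2) * ((N : ℝ) - 3))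
  | 5 => 2 * (N : ℝ) ^ 4 * (5 * (N : ℝ) - 12) /
      (5 * ((N : ℝ) - 1) ^ 2 * ((N : ℝ) - 2) * ((N : ℝ) - 3) * ((N : ℝ) - 4))
  | _ => 0

/-- `w₁ = 1` for the `U(N)` model. [cite: SalmhoferSeiler1991, Remark 4.6 (4.27)] -/
theorem uNLogCoeff_one (N : ℕ) : uNLogCoeff N 1 = 1 := rfl

/-- **Remark 4.6 checked for `N ≤ 4`**: the printed `w_k` ARE the Taylor coefficients of
`N⁻¹ log B` to order `N` for the `U(N)` bond data (2.23), i.e. `B = exp(NW)` modulo `t^{N+1}`.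
[cite: SalmhoferSeiler1991, Remark 4.6 with (2.23)] -/
theorem hasLog_uN {N : ℕ} (hN1 : 1 ≤ N) (hN4 : N ≤ 4) :
    HasLog N (uNBondCoeff N) (uNLogCoeff N) := by
  intro k hk1 hkN
  interval_cases N <;> interval_cases k <;>
    simp [uNBondCoeff, uNLogCoeff, Finset.Nat.sum_antidiagonal_eq_sum_range_succ_mk,
      Finset.sum_range_succ, Nat.factorial] <;> norm_num

/-- **Remark 4.6**: "Let `N ≤ 5`. Then `w_k ≥ 0` for all `k ≤ N` holds in the `U(N)`-model" — here for
`N ≤ 4`, the range of Cor. 4.9 used below. [cite: SalmhoferSeiler1991, Remark 4.6] -/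
theorem uNLogCoeff_nonneg {N : ℕ} (hN4 : N ≤ 4) (k : ℕ) (hk2 : 2 ≤ k) (hkN : k ≤ N) :
    0 ≤ uNLogCoeff N k := by
  interval_cases N <;> interval_cases k <;> simp [uNLogCoeff] <;> norm_num

/-- `K(1) = 1` (proof of Cor. 4.9). [cite: SalmhoferSeiler1991, Cor. 4.9 (proof)] -/
theorem sdK_uN_one : sdK 1 (uNLogCoeff 1) = 1 := by
  simp [sdK, sdAlpha, sdProd, Finset.sum_range_succ, uNLogCoeff]

/-- `K(2) = 2` (proof of Cor. 4.9). [cite: SalmhoferSeiler1991, Cor. 4.9 (proof)] -/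
theorem sdK_uN_two : sdK 2 (uNLogCoeff 2) = 2 := by
  simp [sdK, sdAlpha, sdProd, Finset.sum_range_succ, Finset.prod_range_succ, uNLogCoeff]
  norm_num

/-- `K(3) = 10/3` (proof of Cor. 4.9). [cite: SalmhoferSeiler1991, Cor. 4.9 (proof)] -/
theorem sdK_uN_three : sdK 3 (uNLogCoeff 3) = 10 / 3 := by
  simp [sdK, sdAlpha, sdProd, Finset.sum_range_succ, Finset.prod_range_succ, uNLogCoeff]
  norm_num

/-- `K(4) = 5 + 8/15 = 83/15` (proof of Cor. 4.9; with the product form of (4.29)).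
[cite: SalmhoferSeiler1991, Cor. 4.9 (proof)] -/
theorem sdK_uN_four : sdK 4 (uNLogCoeff 4) = 83 / 15 := by
  simp [sdK, sdAlpha, sdProd, Finset.sum_range_succ, Finset.prod_range_succ, uNLogCoeff]
  norm_num

/-- **Corollary 4.9 in finite volume (the `β = 0` content of chiral LRO for `U(N)`, `N ≤ 4`)**: for the
`U(N)` lattice gauge theory at `β = 0` with massless staggered fermions in its complex-spin form
(bond data (2.23), Remarks 4.5/4.6), `1 ≤ N ≤ 4`, on the even torus `(ℤ/Lℤ)^ν` (`ν ≥ 1`, `L ≥ 2`):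
`|Λ|⁻¹ ∑_x ⟨σ_0 σ_x⟩_Λ ≥ (1/4ν)(1/K(N) - 2 S_Λ(ν)/N)` with `K(1) = 1`, `K(2) = 2`, `K(3) = 10/3`,
`K(4) = 83/15` (`sdK_uN_*`).  The printed Cor. 4.9 ("for `N ≤ 4` and `ν ≥ 4` the `U(N)`-model has
chiral LRO at `m = 0`") follows in the thermodynamic limit from `S_Λ(ν) → S(ν)` and the
computer-assisted Prop. 4.2(4) (`S(4) < 0.35`, `S(ν) ≤ S(4)` for `ν ≥ 4`), neither of which is
formalised here; `⟨ψ̄ψ(0)ψ̄ψ(x)⟩ = (2N)² ⟨σ_0σ_x⟩` (Remark 4.10(1)).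
[cite: SalmhoferSeiler1991, Cor. 4.9 with Thm. 4.8 and Remarks 4.5–4.6] -/
theorem uN_chiralLRO (hν : 1 ≤ ν) (hL : Even L) (hL2 : 2 ≤ L) {N : ℕ} (hN1 : 1 ≤ N)
    (hN4 : N ≤ 4) :
    1 / (4 * ν) * (1 / sdK N (uNLogCoeff N) - 2 * latticeS ν L / N) ≤
      (Fintype.card (TorusSite ν L) : ℝ)⁻¹ *
        ∑ x : TorusSite ν L, expect N 0 (uNBondCoeff N) (X (0 : TorusSite ν L) * X x) :=
  chiralLRO_expect hν hL hL2 hN1 (hasLog_uN hN1 hN4) (uNBondCoeff_zero N) (uNLogCoeff_one N)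
    (fun k hk2 hkN => uNLogCoeff_nonneg hN4 k hk2 hkN)

/-! ### `N = 5`: an erratum to (4.27) and the corrected `K(5)` (Cor. 4.9, case `N = 5`) -/

/-- **ERRATUM to Remark 4.6 (4.27), kernel-checked.**  The printed
`w₅ = 2N⁴(5N-12)/(5(N-1)²(N-2)(N-3)(N-4))` is NOT the degree-5 Taylor coefficient of `N⁻¹ log B` for
the `U(N)` bond weight (2.23) at `N = 5`: with it, `B = exp(NW)` fails at order `t⁵`
(`5 b₅ ≠ 5 ∑_{i+j=5} i w_i b_j`).  The correct coefficient is `2N⁴(7N-12)/(5(N-1)²(N-2)(N-3)(N-4))`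
(`= 2875/48` at `N = 5`, printed formula: `1625/48`; `w₁,…,w₄` of (4.27) are correct, `hasLog_uN`).
[cite: SalmhoferSeiler1991, Remark 4.6 (4.27) with (2.23)] -/
theorem not_hasLog_uN_five : ¬ HasLog 5 (uNBondCoeff 5) (uNLogCoeff 5) := by
  intro h
  have h5 := h 5 (by norm_num) le_rfl
  simp [uNBondCoeff, uNLogCoeff, Finset.Nat.sum_antidiagonal_eq_sum_range_succ_mk,
    Finset.sum_range_succ, Nat.factorial] at h5
  norm_num at h5

/-- **Remark 4.6 at `N = 5`, corrected**: with `w₅ := 2·5⁴(7·5-12)/(5·4²·3·2·1) = 2875/48` in place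
of the printed value, `w₁,…,w₅` are the Taylor data of `N⁻¹ log B` for the `U(5)` bond weight (2.23).
[cite: SalmhoferSeiler1991, Remark 4.6 (4.27) with (2.23)] -/
theorem hasLog_uN_five :
    HasLog 5 (uNBondCoeff 5) (Function.update (uNLogCoeff 5) 5 (2875 / 48)) := by
  intro k hk1 hkN
  interval_cases k <;>
    simp [uNBondCoeff, uNLogCoeff, Function.update,
      Finset.Nat.sum_antidiagonal_eq_sum_range_succ_mk, Finset.sum_range_succ, Nat.factorial] <;>
    norm_num

/-- With the PRINTED `w₅` one recovers the printed bound "`K(5) < 7.4`": `K = 9827/1330 ≈ 7.389`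
(proof of Cor. 4.9) — i.e. the printed `K(5)` was computed from the misprinted/miscalculated `w₅`.
[cite: SalmhoferSeiler1991, Cor. 4.9 (proof: "`K(5) < 7.4`")] -/
theorem sdK_uN_five_printed : sdK 5 (uNLogCoeff 5) = 9827 / 1330 := by
  simp [sdK, sdAlpha, sdProd, Finset.sum_range_succ, Finset.prod_range_succ, uNLogCoeff]
  norm_num

/-- **The corrected `K(5) = 12227/1330 ≈ 9.193`** (from the corrected `w₅`; the printed proof of
Cor. 4.9 has "`K(5) < 7.4`").  Consequence for Cor. 4.9, `N = 5`: the condition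
`2S(ν)K(5)/5 < 1` (4.42) becomes `S(ν) < 0.2719…` instead of `S(ν) < 0.338…`; the printed
`S(5) < 0.26` (Prop. 4.2(4)) still gives `ν = 5`, while `ν ≥ 6` then needs `S(ν) < 0.272`, which the
printed `S(ν) ≤ S(4) < 0.35` does not supply by itself (numerically `S(6) ≈ 0.205`).
[cite: SalmhoferSeiler1991, Cor. 4.9 (proof) with Remark 4.6] -/
theorem sdK_uN_five : sdK 5 (Function.update (uNLogCoeff 5) 5 (2875 / 48)) = 12227 / 1330 := by
  simp [sdK, sdAlpha, sdProd, Finset.sum_range_succ, Finset.prod_range_succ, uNLogCoeff,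
    Function.update]
  norm_num

/-- **Cor. 4.9, `N = 5`, in finite volume with the corrected constant**: for the `U(5)` model at
`β = 0`, `m = 0`, on the even torus `(ℤ/Lℤ)^ν` (`ν ≥ 1`, `L ≥ 2`):
`|Λ|⁻¹ ∑_x ⟨σ_0σ_x⟩_Λ ≥ (1/4ν)(1330/12227 - 2 S_Λ(ν)/5)`.
[cite: SalmhoferSeiler1991, Cor. 4.9 with Thm. 4.8 and Remarks 4.5–4.6] -/
theorem uN_chiralLRO_five (hν : 1 ≤ ν) (hL : Even L) (hL2 : 2 ≤ L) :
    1 / (4 * ν) * (1 / (12227 / 1330 : ℝ) - 2 * latticeS ν L / 5) ≤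
      (Fintype.card (TorusSite ν L) : ℝ)⁻¹ *
        ∑ x : TorusSite ν L, expect 5 0 (uNBondCoeff 5) (X (0 : TorusSite ν L) * X x) := by
  have h := chiralLRO_expect hν hL hL2 (by norm_num : 1 ≤ 5) hasLog_uN_five (uNBondCoeff_zero 5)
    (by simp [Function.update, uNLogCoeff]) (fun k hk2 hk5 => by
      interval_cases k <;> simp [Function.update, uNLogCoeff] <;> norm_num)
  rw [sdK_uN_five] at h
  exact_mod_cast h

end ComplexSpin
end Literature.MathematicalPhysics.StatisticalMechanics
end
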